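import Literature.MathematicalPhysics.QuantumFieldTheory.Balaban1983to89.B9SectBGpStepAtLetters
import Literature.MathematicalPhysics.QuantumFieldTheory.Balaban1983to89.B9Thm34GUniform
import Literature.MathematicalPhysics.QuantumFieldTheory.Balaban1983to89.B9Thm34HolderAllUniform

/-!
# `Balaban1983to89.B9SectBGStepAtLetters` — [B9] Sect. B, the (3.42)-step for the bond-sector operator G(U′U)
# (Theorem 3.4 p. 400 with Theorem 3.3 p. 399: *"the operator G(U) (a = 1) satisfies the inequalities (3.42)–(3.47),
# with G′(U) replaced by G(U)"*; p. 407 (3.84)–(3.86) *"This way we get all these inequalities for the operator G(U′U)"*)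
# PINNED AT THE LETTERS of the tree's Sect. B programme: the letters dictionary `GFrame` for the G family,
# ★ `entries342_ext_of_gFrame` (the four (3.42)-type majorants of G(U′U)), ★ `stepEPos_of_gFrame : GFrame … → StepEPos … GA`
# and, on the same letters, `GlobGFrame` ∕ ★ `stepGlobPos_of_globGFrame` (the (3.47) block of G(U′U)) and `L2GFrame` ∕
# ★ `stepL2nPos_of_l2GFrame` (the L² members (3.46)₁,₂,₃,₅ of G(U′U), with the kernel-form input displayed as the law `kerG`),
# `AnGFrame` ∕ ★ `stepAnalyticPos1_of_anGFrame` (the analytic-extension step, G half), `H1GFrame` ∕ ★ `stepH1Pos_of_h1GFrame`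
# (the Hölder block (3.43) of G(U′U) from r06's per-probe transfers); `KerGFrame` carries the kernel-form law `kerG`

T. Bałaban, *Propagators for lattice gauge theories in a background field*, Commun. Math. Phys. **99** (1985) 389–434
[`Balaban1985BackgroundPropagators`, "B9"]; [4] = T. Bałaban, *Propagators and renormalization transformations for lattice
gauge theories. II*, Commun. Math. Phys. **96** (1984) 223–250 [`Balaban1984PropagatorsII`].

statement-level skeleton of published theorems with citation tags; proofs where landed; nothing here is a claim about the
Yang–Mills mass gap

THE PRINTED LOCUS (verbatim).  Theorem 3.4, p. 400: *"There exists a positive constant a₁ such that the operators G′(U),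
(Q′(U)G′²(U)Q′*(U))⁻¹, R(U), G(U) extend to configurations U′U for α₁ ≦ a₁ as analytic functions of A. The extended
operators satisfy all the inequalities of Theorems 3.1–3.3 correspondingly."*; p. 407, (3.82)–(3.86): *"Δ_a(U′U) = Δ_a(U)
− V(A) … G(U′U) = G(U)(I − V(A)G(U))⁻¹ = Σ_{n=0}^∞ G(U)(V(A)G(U))ⁿ … for α₁ sufficiently small the series is convergent …
This way we get all these inequalities for the operator G(U′U)"*; (3.68) p. 403: *"P(U′U) = P(U) + P′(A)"*; (3.25) p. 394
(`R(U) = I − G′Q′*(Q′G′²Q′*)⁻¹Q′G′`), (3.30) p. 395 (`Δ_a(U) = Δ(U) + D_U R(U) D_U* + Q*(U) a Q(U)`, `G(U) = Δ_a(U)⁻¹`).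

THE POINT.  `B9SectBGpStepAtLetters` (v1–v1.2, seat `pub-ymgap-dag-n06-c` g2) wrote the letters dictionary of the Sect.-B
block-steps for the SITE-sector family G′ (`GpFrame`, `CinvFrame`, …) and inhabited 13 of the 24 positive-input steps of
`B9SectBStepWhole.sectBStepPrinted_of_posBlockSteps` from r06's uniform Theorem-3.4 clauses.  THIS FILE does the same for the
BOND-sector family G (Theorem 3.3's operator, the `GA` family of the N06 record): the structure `GFrame` extends `CinvFrame` by
EXACTLY the extra hypotheses of r06's uniform `G(U′U)`-clause `B9Thm34GUniform.thm34_G_clause_uniform` per member of the family —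
commuting shifts, `1 ≦ L`, the (3.35) plaquette reading at the bond's block scale (law `reg335`, frame-level constant `C₀` above
the thresholds), the three extra stencils, a section `rep` of the block map (FILE 17 of r06), the bond letters `Gb i V` = G(V),
`Qb i V` = Q(V), `Qsb i V` = Q*(V) (3.15), the weight letter `ab i` = a of (3.24)∕(3.26), the (3.80)–(3.81) variations `F₂`, `F₂s`,
the bond Laplacian letter `LapB i U` (fourth (3.42) entry) — plus the LAWS an operator-layer instance must prove: `gb_eq` (G(V) is
THE two-sided inverse of the frame's concrete Δ_a(V) — r06's `B9Eq386Neumann.deltaA` word in the letters at V — whenever one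
exists), `reg_ginv` (one exists at (3.35)-regular U above the thresholds: Thm 3.3 ∕ 3.11), `coord_mul` (the background of U′U
is `B9Eq39Adjoint.prodCfg U η A` on the class (3.37)), `qb_mul` ((3.80): Q(U′U) = Q(U) + F₂(A), Q*(U′U) = Q*(U) + F₂*(A)),
`cplxG` (the seven further blockwise readings of (3.37) r06's G-clause consumes), block-majorant sizes of the bond letters at
every rate below a frame cap `δcap` (`hQb`, `hQsb`, `hF₂`; the rate device: block-local letters have majorants
`κ·e^{δcap·d₀}·e^{−δd}` for every δ ≦ δcap), `readG342` ∕ `writeG342` (the (3.42) block of `GA` at U, resp. U′U, ARE block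
majorants of the bond letters, *"of course with different constants"* p. 403) — and proves ★ `entries342_ext_of_gFrame` (the
four (3.42)-type block majorants of the family's own G(U′U) at `(B, δr/6)`, constants before the member) and from it
★ `stepEPos_of_gFrame`: ANY such frame inhabits the positive-input (3.42)-step `B9SectBStepWhole.StepEPos F.dB c35 geo bg Gp GA Cinv GA`;
`GlobGFrame` adds the (3.47) writing and ★ `stepGlobPos_of_globGFrame` inhabits `StepGlobPos F.dB … GA`; `L2GFrame` adds the
block volumes of the bond carrier, [4] Lemma 2.1 for `v^{−1/2}`, the NAMED LAW `kerG` (Theorem 3.3 for G(U) in the printed KERNEL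
form — N06 content, displayed, exactly as `B9SectBGpStepAtLetters.L2Frame.ker31` for G′) and the L² writing, and
★ `stepL2nPos_of_l2GFrame` inhabits `StepL2nPos F.dB … GA n` for n = 0, 1, 2, 4 from `B9Ineq346L2Uniform.thm34_G_l2_uniform`;
`AnGFrame` adds the analytic-extension writing and ★ `stepAnalyticPos1_of_anGFrame` inhabits `StepAnalyticPos1 F.dB … GA` from the
inverse identities of `entries342_ext_of_gFrame`; `H1GFrame` adds the single per-probe transfer field `h1G_transfer` and
★ `stepH1Pos_of_h1GFrame` inhabits `StepH1Pos F.dB … GA` from `B9Thm34HolderAllUniform.thm34_all_holder_uniform` (iii)(iv) (the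
G-twins of `B9SectBGpStepAtLetters.entries342_ext_of_gpFrame` ∕ `GlobFrame` ∕ `L2Frame` ∕ `H1Frame` ∕ `B9SectBGpStepAtLettersAn.AnFrame`
and their step theorems).

THE ONE NON-BOOKKEEPING STEP (`rZero_add_pPrime_sections`).  r06's G-clause concludes that its `GExt` inverts the concrete
Δ_a(U′U) whose R-word is written THROUGH THE SECTION: `(G′Q′*C⁻¹Q′G′)(U) + P′(A)` with
`P′(A) = pOp E (Q′*(U′U)∘rep*) (rep_! C⁻¹(U′U) rep*) (rep_!∘Q′(U′U)) − pOp G′(U) (…U…)` ((3.68), `B9Eq360Vprime.pPrime`); for an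
injective section (`rep* ∘ rep_! = id`, `B6RandomWalkSection.secRes_comp_secExt`) this IS the word `G′(U′U)Q′*(U′U)C⁻¹(U′U)Q′(U′U)G′(U′U)`
read directly — so after the three uniqueness identifications (G′(U′U) = r06's extension by `gop_eq`, C⁻¹(U′U) = r06's `Tinv` by
`cop_eq`, then G(U′U) = r06's `GExt` by `gb_eq`) the transferred majorants are majorants of the family's own G(U′U).

HONEST SCOPE.  Nothing of print is asserted and no operator of [B9] is constructed: `GFrame` is a hypothesis structure (the
contract an instance meets), `thm34_G_clause_uniform` ∕ `thm34_Gp_uniform` are USED BY NAME, the theorem is quantifier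
bookkeeping + uniqueness of two-sided inverses + the section identity above.  Rates: the step is called at
`δr = min(min(δ₀, δ₁), δcap)` (all inputs lowered to it), output `(wBG B (δr/6), wδG (δr/6))`.  The frame is not shown inhabited
here (its inhabitant is the operator layer of record — NODE 00 def-Y's bond sector `deltaAY`/`GAY`, in progress — not in the
tree); count-neutral; NOT a node discharge; nothing continuum, nothing about the mass gap.  Cell `pub-ymgap` (HUMAN RULING
D-0062), Track A node N06 [B9], N06-ASSIGNMENT row 13, seat `pub-ymgap-dag-n06-c` (g3), 2026-08-27 (steps 13-E(G), 13-Glob(G), 13-H1(G), 13-L2ₙ(G) n = 0,1,2,4, 13-An(G)).  The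
input-Hölder (3.44)∕(3.45) and two-difference L² G-steps want sibling frames on the same letters (over
`B9Thm34HolderInputGUniform`, `B9Ineq346L2SecondDiffUniform`, `B9Ineq346L2RightDiffGUniform`).
-/

noncomputable section

namespace Literature.MathematicalPhysics.QuantumFieldTheory.Balaban1983to89.B9SectBGStepAtLetters

open Literature.MathematicalPhysics.QuantumFieldTheory.Balaban1983to89
open Literature.MathematicalPhysics.QuantumFieldTheory.Balaban1983to89.B6RandomWalk (HasMajorant hasMajorant_mono Triangle254 Ineq261)
open Literature.MathematicalPhysics.QuantumFieldTheory.Balaban1983to89.B6RandomWalkHom (HasMajorantHom)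
open Literature.MathematicalPhysics.QuantumFieldTheory.Balaban1983to89.B6RandomWalkSection (secExt secRes secConj secConj_def
  secRes_comp_secExt)
open Literature.MathematicalPhysics.QuantumFieldTheory.Balaban1983to89.B9Thm34Ext (toB6)
open Literature.MathematicalPhysics.QuantumFieldTheory.Balaban1983to89.B9Ineq347 (ScaleTransfer)
open Literature.MathematicalPhysics.QuantumFieldTheory.Balaban1983to89.B9Eq39Adjoint (covD covDstar prodCfg plaqU)
open Literature.MathematicalPhysics.QuantumFieldTheory.Balaban1983to89.B9Eq369Small (Through)
open Literature.MathematicalPhysics.QuantumFieldTheory.Balaban1983to89.B9Eq372Locality (stBonds)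
open Literature.MathematicalPhysics.QuantumFieldTheory.Balaban1983to89.B9Eq352DivForm (tauF tauB)
open Literature.MathematicalPhysics.QuantumFieldTheory.Balaban1983to89.B9Eq352DivFormLetters (conj)
open Literature.MathematicalPhysics.QuantumFieldTheory.Balaban1983to89.B9Eq352GradLetters (diffLetter)
open Literature.MathematicalPhysics.QuantumFieldTheory.Balaban1983to89.B9Eq371GradLetters (bT bU)
open Literature.MathematicalPhysics.QuantumFieldTheory.Balaban1983to89.B9Eq372RemLetters (lapDDLetter)
open Literature.MathematicalPhysics.QuantumFieldTheory.Balaban1983to89.B9Eq382V3Letters (dPrimeLetter)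
open Literature.MathematicalPhysics.QuantumFieldTheory.Balaban1983to89.B9Eq376POneLetters (conjHom gradLin divLin)
open Literature.MathematicalPhysics.QuantumFieldTheory.Balaban1983to89.B9Eq386Neumann (pTwo deltaA)
open Literature.MathematicalPhysics.QuantumFieldTheory.Balaban1983to89.B9Eq360Vprime (gPrimeExtEnd pPrime pOp)
open Literature.MathematicalPhysics.QuantumFieldTheory.Balaban1983to89.B9Eq360VprimeLetters (vPrimeConc)
open Literature.MathematicalPhysics.QuantumFieldTheory.Balaban1983to89.B9Thm34SectBUniform (thm34_Gp_uniform)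
open Literature.MathematicalPhysics.QuantumFieldTheory.Balaban1983to89.B9Thm34GUniform (thm34_G_clause_uniform)
open Literature.MathematicalPhysics.QuantumFieldTheory.Balaban1983to89.B9Ineq346L2Uniform (thm34_G_l2_uniform)
open Literature.MathematicalPhysics.QuantumFieldTheory.Balaban1983to89.B6RandomWalkKernel (HasKernelBound hasKernelBound_mono)
open Literature.MathematicalPhysics.QuantumFieldTheory.Balaban1983to89.B9FromB6 (EBlock)
open Literature.MathematicalPhysics.QuantumFieldTheory.Balaban1983to89.B9SectBStepWhole (StepPos StepEPos)
open Literature.MathematicalPhysics.QuantumFieldTheory.Balaban1983to89.B9SectBGpStepAtLetters (GpFrame CinvFrame)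

universe u

variable {I : Type} (d : ℕ) (c35 : ℝ) (geo : I → B9.Geometry) (bg : I → B9.Backgrounds)
  (Gp : ∀ i, B9.KernelFamily (geo i) (bg i))
  {𝔸 : Type u} [NormedRing 𝔸] [NormedAlgebra ℂ 𝔸] [CompleteSpace 𝔸] {ι : Type} [Fintype ι] [DecidableEq ι]
  (b : Module.Basis ι ℝ 𝔸) (κ : Type) [Fintype κ] [LinearOrder κ]
  (S : I → Type) [∀ i, Fintype (S i)] [∀ i, DecidableEq (S i)]
  [∀ i, Fintype (geo i).Site] [∀ i, DecidableEq (geo i).Site] [∀ i, Nonempty (geo i).Site]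

/-! ## The section identity: r06's `R₀ + P′(A)` through the section is the word `P(U′U)` read directly -/

/-- `R₀ + P′(A)` through the section letters equals `P(U′U)` read directly: for an injective section `rep`,
`(A∘Q*∘C⁻¹∘Q∘A) + pPrime A E (Q*∘rep*) (Q*′∘rep*) (rep_! C⁻¹ rep*) (rep_! T⁻¹ rep*) (rep_!∘Q) (rep_!∘Q′) = E∘Q*′∘T⁻¹∘Q′∘E`
(`rep* ∘ rep_! = id` twice inside `pOp`, then the U-words cancel). [cite: Balaban1985BackgroundPropagators, (3.68) p.403 + (3.25) p.394] -/
theorem rZero_add_pPrime_sections {X Z : Type} {rep : Z → X} (hinj : Function.Injective rep)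
    (A E : Module.End ℝ (X → ℝ)) (Qcs Qcs' : (Z → ℝ) →ₗ[ℝ] (X → ℝ)) (Qc Qc' : (X → ℝ) →ₗ[ℝ] (Z → ℝ))
    (Linv Tinv : Module.End ℝ (Z → ℝ)) :
    (A ∘ₗ Qcs ∘ₗ Linv ∘ₗ Qc ∘ₗ A) +
        pPrime A E (Qcs ∘ₗ secRes rep) (Qcs' ∘ₗ secRes rep) (secConj rep Linv) (secConj rep Tinv)
          (secExt rep ∘ₗ Qc) (secExt rep ∘ₗ Qc') =
      E ∘ₗ Qcs' ∘ₗ Tinv ∘ₗ Qc' ∘ₗ E := by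
  have collapse : ∀ M : (X → ℝ) →ₗ[ℝ] (Z → ℝ), secRes rep ∘ₗ (secExt rep ∘ₗ M) = M := fun M => by
    rw [← LinearMap.comp_assoc, secRes_comp_secExt hinj, LinearMap.id_comp]
  have key : ∀ (B : Module.End ℝ (X → ℝ)) (Qs : (Z → ℝ) →ₗ[ℝ] (X → ℝ)) (Q : (X → ℝ) →ₗ[ℝ] (Z → ℝ))
      (L : Module.End ℝ (Z → ℝ)),
      pOp B (Qs ∘ₗ secRes rep) (secConj rep L) (secExt rep ∘ₗ Q) = B ∘ₗ Qs ∘ₗ L ∘ₗ Q ∘ₗ B := by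
    intro B Qs Q L
    simp only [pOp, secConj_def, Module.End.mul_eq_comp, LinearMap.comp_assoc, collapse]
  rw [pPrime, key, key]
  abel

/-- Rate bookkeeping for block majorants: a majorant `c·P(a)·e^{−δd}` with `c·P ≧ 0` stays one at any smaller rate `δ′ ≦ δ`
(d ≧ 0). [folklore] -/
private theorem hasMajorant_rate_le {g : B6.Geometry} {X : Type} (blk : X → g.Site) {T : Module.End ℝ (X → ℝ)}
    {c δ δ' : ℝ} (P : g.Site → ℝ) (hc : ∀ a, 0 ≤ c * P a) (hδ : δ' ≤ δ) (hd : ∀ a a' : g.Site, 0 ≤ g.dist a a')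
    (h : HasMajorant blk T (fun a a' => c * P a * Real.exp (-(δ * g.dist a a')))) :
    HasMajorant blk T (fun a a' => c * P a * Real.exp (-(δ' * g.dist a a'))) :=
  hasMajorant_mono blk h fun a a' =>
    mul_le_mul_of_nonneg_left (Real.exp_le_exp.2 (by nlinarith [hd a a', hδ])) (hc a)

/-! ## The letters dictionary for the bond-sector family G -/

/-- **THE LETTERS DICTIONARY FOR THE G FAMILY** (Theorem 3.3's bond-sector operator `G(U) = Δ_a(U)⁻¹` (3.30), the `GA` family of
the N06 record) — `CinvFrame` (the site-sector letters of G′ and C⁻¹ with their laws) extended by EXACTLY the further hypotheses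
of r06's uniform G-clause `B9Thm34GUniform.thm34_G_clause_uniform` per member `i`: commuting shifts (`T_comm`), `1 ≦ L`
(`L_one_le`), the (3.35) plaquette reading at the bond's block scale with a frame-level constant `C₀` above the thresholds
(`reg335`), the extra stencils (`stencilFB`, `stencilSt`, `stencilLoc`), a section of the block map (`rep`, `hrep` — FILE 17 of
r06), the bond letters `Gb i V` = G(V) (3.27)∕(3.30), `Qb i V` = Q(V), `Qsb i V` = Q*(V) (3.15), the weight letter `ab i` = a of
(3.24)∕(3.26) (`ha324`), the (3.80)–(3.81) variations `F₂ i U U′`, `F₂s i U U′`, the bond Laplacian letter `LapB i U` (fourth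
(3.42) entry); the frame-level constants `C₀ κQb cFb abar`, the rate cap `δcap`, the reading constant `cRG`, the writing
functions `wBG wδG`; and the LAWS: `gb_eq` (G(V) is THE two-sided inverse of the concrete Δ_a(V) of (3.30)∕(3.82)–(3.84) —
r06's `deltaA` word in the letters at V with R(V) by the algebraic (3.25) — whenever one exists), `reg_ginv` (one exists at
(3.35)-regular U above the thresholds, Thm 3.3 ∕ 3.11), `coord_mul` (the background of U′U on the class (3.37) is
`prodCfg U η A`), `qb_mul` ((3.80)), `hQb`∕`hQsb`∕`hF₂` (block-majorant sizes of the bond letters at every rate `δ ≦ δcap`),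
`cplxG` (the seven further blockwise (3.37) readings), `readG342` ∕ `writeG342` (the (3.42) block of `GA` ↔ block majorants of the
bond letters, both ways).  Field shapes = the hypotheses of `thm34_G_clause_uniform` verbatim.  A hypothesis structure; nothing
asserted. [cite: Balaban1985BackgroundPropagators, Thm 3.4 p.400 + Thm 3.3 p.399 + (3.15) p.393 + (3.24)–(3.27) p.394 + (3.30) p.395 + (3.35)/(3.37) p.396 + Thm 3.1 (3.42) p.397 + (3.68) p.403 + (3.80)–(3.86) p.407 + Thm 3.11 p.416; Balaban1984PropagatorsII, (2.51) p.232 + Lemma 2.1 p.234] -/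
structure GFrame (GA : ∀ i, B9.KernelFamily (geo i) (bg i)) (Cinv : ∀ i, B9.SiteKernel (geo i) (bg i))
    extends CinvFrame c35 geo bg Gp b κ S Cinv where
  /-- (3.35) plaquette constant, (3.15) bond-letter size, (3.80)–(3.81) size, the weight bound ā of (3.24), rate cap,
  reading constant and writing functions for the G family. -/
  C₀ : ℝ
  κQb : ℝ
  cFb : ℝ
  abar : ℝ
  δcap : ℝ
  cRG : ℝ
  wBG : ℝ → ℝ → ℝ
  wδG : ℝ → ℝ
  C₀_nonneg : 0 ≤ C₀
  κQb_nonneg : 0 ≤ κQb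
  cFb_nonneg : 0 ≤ cFb
  abar_nonneg : 0 ≤ abar
  δcap_pos : 0 < δcap
  cRG_pos : 0 < cRG
  wBG_pos : ∀ B δ : ℝ, 0 ≤ B → 0 < δ → 0 < wBG B δ
  wδG_pos : ∀ δ : ℝ, 0 < δ → 0 < wδG δ
  /-- per member: the section of the block map, the bond letters. -/
  rep : ∀ i, (geo i).Site → S i × ι
  Gb : ∀ i, (bg i).Cfg → Module.End ℝ ((κ × S i) × ι → ℝ)
  Qb : ∀ i, (bg i).Cfg → Module.End ℝ ((κ × S i) × ι → ℝ)
  Qsb : ∀ i, (bg i).Cfg → Module.End ℝ ((κ × S i) × ι → ℝ)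
  ab : ∀ i, Module.End ℝ ((κ × S i) × ι → ℝ)
  F₂ : ∀ i, (bg i).Cfg → (bg i).Cfg → Module.End ℝ ((κ × S i) × ι → ℝ)
  F₂s : ∀ i, (bg i).Cfg → (bg i).Cfg → Module.End ℝ ((κ × S i) × ι → ℝ)
  LapB : ∀ i, (bg i).Cfg → Module.End ℝ ((κ × S i) × ι → ℝ)
  /-- `L ≧ 1`, commuting shifts, the section property `blk (rep y) = y`. -/
  L_one_le : ∀ i, 1 ≤ (geo i).L
  T_comm : ∀ i (μ ν : κ) (x : S i), T i μ (T i ν x) = T i ν (T i μ x)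
  hrep : ∀ i (y : (geo i).Site), blk i (rep i y).1 = y
  /-- the three further stencils of r06's G-clause at range `d₀`. -/
  stencilFB : ∀ i (μ ν : κ) (x : S i), (geo i).dist (blk i x) (blk i ((T i ν).symm (T i μ x))) ≤ d₀
  stencilSt : ∀ i (μ : κ) (x : S i) (q : κ × S i), q ∈ stBonds (T i) μ x → (geo i).dist (blk i x) (blk i q.2) ≤ d₀
  stencilLoc : ∀ i (μ : κ) (x : S i) (q : κ × S i), q ∈ B9Eq375Locality.locBondsA' (T i) μ x →
    (geo i).dist (blk i x) (blk i q.2) ≤ d₀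
  /-- LAW (3.35) READ ON PLAQUETTES: at a (3.35)-regular U above the thresholds, every plaquette through a bond is within
  `C₀·(L^{j})^{−2}` of 1 at that bond's block scale (frame-level `C₀`, since `Mα₀ ≦ aInv`). -/
  reg335 : ∀ i (α₀ : ℝ) (U : (bg i).Cfg), MInv ≤ (geo i).M → 0 < α₀ → (geo i).M * α₀ ≤ aInv → (bg i).Reg335 c35 α₀ U →
    ∀ (μ : κ) (x : S i) (m n : κ) (y : S i), Through (T i) μ x m n y →
      ‖(plaqU (T i) (coord i U) m n y : 𝔸) - 1‖ ≤ C₀ * (((geo i).L ^ (geo i).scale (blk i x))⁻¹) ^ 2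
  /-- (3.15): Q(V), Q*(V) have block majorants `κQb·e^{−δd}` at every rate `0 < δ ≦ δcap` (block-local letters). -/
  hQb : ∀ i (V : (bg i).Cfg) (δ : ℝ), 0 < δ → δ ≤ δcap →
    HasMajorant (g := toB6 (geo i) (Rr i) (Hp i)) (fun q : (κ × S i) × ι => blk i q.1.2) (Qb i V)
      (fun a a' => κQb * Real.exp (-(δ * (geo i).dist a a')))
  hQsb : ∀ i (V : (bg i).Cfg) (δ : ℝ), 0 < δ → δ ≤ δcap →
    HasMajorant (g := toB6 (geo i) (Rr i) (Hp i)) (fun q : (κ × S i) × ι => blk i q.1.2) (Qsb i V)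
      (fun a a' => κQb * Real.exp (-(δ * (geo i).dist a a')))
  /-- (3.24)∕(3.26): the weight letter `a` is block-diagonal with entries `≦ ā·(Lʲη)^{−2}`. -/
  ha324 : ∀ i, HasMajorant (g := toB6 (geo i) (Rr i) (Hp i)) (fun q : (κ × S i) × ι => blk i q.1.2) (ab i)
    (fun a a' : (geo i).Site => if a = a' then abar * ((geo i).len a ^ 2)⁻¹ else 0)
  /-- `G(V)` is THE two-sided inverse of the concrete `Δ_a(V)` (r06's `deltaA` word in the letters at V, R(V) by (3.25))
  whenever one exists (every configuration, complex ones included). -/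
  gb_eq : ∀ i (V : (bg i).Cfg) (D X : Module.End ℝ ((κ × S i) × ι → ℝ)),
    deltaA (conj b (lapDDLetter (T i) ((((geo i).eta : ℂ))⁻¹) (coord i V))) (conj b (dPrimeLetter (T i) (coord i V) (geo i).eta))
        (conjHom b (gradLin (T i) ((((geo i).eta : ℂ))⁻¹) (coord i V)) ∘ₗ
            (1 - (Gop i V ∘ₗ Qcs i V ∘ₗ Cop i V ∘ₗ Qc i V ∘ₗ Gop i V)) ∘ₗ
          conjHom b (divLin (T i) ((((geo i).eta : ℂ))⁻¹) (coord i V))) (Qsb i V) (ab i) (Qb i V) = D →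
    D * X = 1 → X * D = 1 → Gb i V = X
  /-- Theorem 3.3 ∕ 3.11: at a (3.35)-regular U above the thresholds, the concrete Δ_a(U) is inverted by G(U). -/
  reg_ginv : ∀ i (α₀ : ℝ) (U : (bg i).Cfg), MInv ≤ (geo i).M → 0 < α₀ → (geo i).M * α₀ ≤ aInv → (bg i).Reg335 c35 α₀ U →
    deltaA (conj b (lapDDLetter (T i) ((((geo i).eta : ℂ))⁻¹) (coord i U))) (conj b (dPrimeLetter (T i) (coord i U) (geo i).eta))
        (conjHom b (gradLin (T i) ((((geo i).eta : ℂ))⁻¹) (coord i U)) ∘ₗ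
            (1 - (Gop i U ∘ₗ Qcs i U ∘ₗ Cop i U ∘ₗ Qc i U ∘ₗ Gop i U)) ∘ₗ
          conjHom b (divLin (T i) ((((geo i).eta : ℂ))⁻¹) (coord i U))) (Qsb i U) (ab i) (Qb i U) * Gb i U = 1 ∧
    Gb i U * deltaA (conj b (lapDDLetter (T i) ((((geo i).eta : ℂ))⁻¹) (coord i U)))
        (conj b (dPrimeLetter (T i) (coord i U) (geo i).eta))
        (conjHom b (gradLin (T i) ((((geo i).eta : ℂ))⁻¹) (coord i U)) ∘ₗ
            (1 - (Gop i U ∘ₗ Qcs i U ∘ₗ Cop i U ∘ₗ Qc i U ∘ₗ Gop i U)) ∘ₗ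
          conjHom b (divLin (T i) ((((geo i).eta : ℂ))⁻¹) (coord i U))) (Qsb i U) (ab i) (Qb i U) = 1
  /-- on the class (3.37): U′ = e^{iηA} with A = `expA i U U′`, so the lattice field of U′U is `prodCfg U η A`. -/
  coord_mul : ∀ i (α₁ : ℝ) (U U' : (bg i).Cfg), 0 < α₁ → (bg i).Cplx337 α₁ U U' →
    coord i ((bg i).mul U' U) = prodCfg (coord i U) (geo i).eta (expA i U U')
  /-- (3.80): Q(U′U) = Q(U) + F₂(A), Q*(U′U) = Q*(U) + F₂*(A) on the class (3.37). -/
  qb_mul : ∀ i (α₁ : ℝ) (U U' : (bg i).Cfg), 0 < α₁ → (bg i).Cplx337 α₁ U U' →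
    Qb i ((bg i).mul U' U) = Qb i U + F₂ i U U' ∧ Qsb i ((bg i).mul U' U) = Qsb i U + F₂s i U U'
  /-- (3.81): `|F₂(A)|, |F₂*(A)| ≦ O(1)α₁` as block majorants `cFb·α₁·e^{−δd}` at every rate `0 < δ ≦ δcap`. -/
  hF₂ : ∀ i (α₁ : ℝ) (U U' : (bg i).Cfg), 0 < α₁ → (bg i).Cplx337 α₁ U U' → ∀ δ : ℝ, 0 < δ → δ ≤ δcap →
    HasMajorant (g := toB6 (geo i) (Rr i) (Hp i)) (fun q : (κ × S i) × ι => blk i q.1.2) (F₂ i U U')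
        (fun a a' => cFb * α₁ * Real.exp (-(δ * (geo i).dist a a'))) ∧
      HasMajorant (g := toB6 (geo i) (Rr i) (Hp i)) (fun q : (κ × S i) × ι => blk i q.1.2) (F₂s i U U')
        (fun a a' => cFb * α₁ * Real.exp (-(δ * (geo i).dist a a')))
  /-- the class (3.37) read blockwise: the seven FURTHER bounds of `thm34_G_clause_uniform` (beyond `cplx`). -/
  cplxG : ∀ i (α₁ : ℝ) (U U' : (bg i).Cfg), 0 < α₁ → (bg i).Cplx337 α₁ U U' →
    (∀ (μ ν : κ) (x : S i), ‖(((geo i).eta : ℂ))⁻¹ • covDstar (T i) (coord i U) ν (expA i U U' ν) (T i μ x)‖ ≤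
      α₁ * ((geo i).len (blk i x) ^ 2)⁻¹) ∧
    (∀ (μ ν k : κ) (x : S i), ‖(((geo i).eta : ℂ))⁻¹ • covD (T i) (coord i U) μ (expA i U U' k) ((T i ν).symm x)‖ ≤
      α₁ * ((geo i).len (blk i x) ^ 2)⁻¹) ∧
    (∀ (μ k : κ) (x : S i), ‖tauF (T i) (coord i U) μ (expA i U U' k) x‖ ≤ α₁ * ((geo i).len (blk i x))⁻¹) ∧
    (∀ (k μ ν : κ) (x : S i), ‖expA i U U' k ((T i ν).symm (T i μ x))‖ ≤ α₁ * ((geo i).len (blk i x))⁻¹) ∧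
    (∀ (μ : κ) (x : S i) (m : κ) (z : S i), (m, z) ∈ stBonds (T i) μ x → ‖expA i U U' m z‖ ≤ α₁ * ((geo i).len (blk i x))⁻¹) ∧
    (∀ (μ : κ) (x : S i) (m : κ) (z : S i), (m, z) ∈ B9Eq375Locality.locBondsA (T i) μ x →
      ‖expA i U U' m z‖ ≤ α₁ * ((geo i).len (blk i x))⁻¹) ∧
    (∀ (μ : κ) (x : S i) (m n : κ) (y : S i), Through (T i) μ x m n y →
      ‖covD (T i) (coord i U) m (expA i U U' n) y‖ ≤ (geo i).eta * (α₁ * (((geo i).len (blk i x))⁻¹) ^ 2) ∧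
        ‖covD (T i) (coord i U) n (expA i U U' m) y‖ ≤ (geo i).eta * (α₁ * (((geo i).len (blk i x))⁻¹) ^ 2))
  /-- READING: the (3.42) block of `GA` at U with (B₀, δ) ⇒ block majorants of the four bond letters of G(U) with (cRG·B₀, δ). -/
  readG342 : ∀ i (α₀ : ℝ) (U : (bg i).Cfg) (B₀ δ : ℝ), MInv ≤ (geo i).M → 0 < α₀ → (geo i).M * α₀ ≤ aInv →
    (bg i).Reg335 c35 α₀ U → 0 < B₀ → 0 < δ → EBlock (GA i) B₀ δ U →
    HasMajorant (g := toB6 (geo i) (Rr i) (Hp i)) (fun q : (κ × S i) × ι => blk i q.1.2) (Gb i U)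
        (fun a a' => cRG * B₀ * (geo i).len a ^ 2 * Real.exp (-(δ * (geo i).dist a a'))) ∧
      (∀ k : κ ⊕ κ, HasMajorant (g := toB6 (geo i) (Rr i) (Hp i)) (fun q : (κ × S i) × ι => blk i q.1.2)
        (conj b (diffLetter (bT (T i)) (bU (coord i U)) ((((geo i).eta : ℂ))⁻¹) k) * Gb i U)
        (fun a a' => cRG * B₀ * (geo i).len a * Real.exp (-(δ * (geo i).dist a a')))) ∧
      (∀ k : κ ⊕ κ, HasMajorant (g := toB6 (geo i) (Rr i) (Hp i)) (fun q : (κ × S i) × ι => blk i q.1.2)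
        (Gb i U * conj b (diffLetter (bT (T i)) (bU (coord i U)) ((((geo i).eta : ℂ))⁻¹) k))
        (fun a a' => cRG * B₀ * (geo i).len a * Real.exp (-(δ * (geo i).dist a a')))) ∧
      HasMajorant (g := toB6 (geo i) (Rr i) (Hp i)) (fun q : (κ × S i) × ι => blk i q.1.2) (LapB i U * Gb i U)
        (fun a a' => cRG * B₀ * 1 * Real.exp (-(δ * (geo i).dist a a')))
  /-- WRITING: block majorants of the four bond letters of G(U′U) (letters ∇_{U,k}, Δ_U at the real U) with (B, δ) ⇒ the (3.42)
  block of `GA` at U′U with (wBG B δ, wδG δ), for U′ in the class (3.37) at α₁ ≦ aW. -/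
  writeG342 : ∀ i (U U' : (bg i).Cfg) (α₁ B δ : ℝ), 0 < α₁ → α₁ ≤ aW → (bg i).Cplx337 α₁ U U' → 0 ≤ B → 0 < δ →
    HasMajorant (g := toB6 (geo i) (Rr i) (Hp i)) (fun q : (κ × S i) × ι => blk i q.1.2) (Gb i ((bg i).mul U' U))
        (fun a a' => B * (geo i).len a ^ 2 * Real.exp (-(δ * (geo i).dist a a'))) →
    (∀ k : κ ⊕ κ, HasMajorant (g := toB6 (geo i) (Rr i) (Hp i)) (fun q : (κ × S i) × ι => blk i q.1.2)
        (conj b (diffLetter (bT (T i)) (bU (coord i U)) ((((geo i).eta : ℂ))⁻¹) k) * Gb i ((bg i).mul U' U))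
        (fun a a' => B * (geo i).len a * Real.exp (-(δ * (geo i).dist a a')))) →
    (∀ k : κ ⊕ κ, HasMajorant (g := toB6 (geo i) (Rr i) (Hp i)) (fun q : (κ × S i) × ι => blk i q.1.2)
        (Gb i ((bg i).mul U' U) * conj b (diffLetter (bT (T i)) (bU (coord i U)) ((((geo i).eta : ℂ))⁻¹) k))
        (fun a a' => B * (geo i).len a * Real.exp (-(δ * (geo i).dist a a')))) →
    HasMajorant (g := toB6 (geo i) (Rr i) (Hp i)) (fun q : (κ × S i) × ι => blk i q.1.2)
        (LapB i U * Gb i ((bg i).mul U' U)) (fun a a' => B * 1 * Real.exp (-(δ * (geo i).dist a a'))) →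
    EBlock (GA i) (wBG B δ) (wδG δ) ((bg i).mul U' U)

variable {d c35 geo bg Gp b κ S}

/-- The frame's concrete `Δ_a(V)` word ((3.30) ∕ (3.82)–(3.84) in r06's letters at V, with R(V) by the algebraic (3.25)):
the `D` of the laws `gb_eq` ∕ `reg_ginv`. [cite: Balaban1985BackgroundPropagators, (3.30) p.395 + (3.25) p.394 + (3.82)–(3.84) p.407] -/
def GFrame.DeltaA {GA : ∀ i, B9.KernelFamily (geo i) (bg i)} {Cinv : ∀ i, B9.SiteKernel (geo i) (bg i)}
    (F : GFrame c35 geo bg Gp b κ S GA Cinv) (i : I) (V : (bg i).Cfg) : Module.End ℝ ((κ × S i) × ι → ℝ) :=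
  deltaA (conj b (lapDDLetter (F.T i) ((((geo i).eta : ℂ))⁻¹) (F.coord i V)))
    (conj b (dPrimeLetter (F.T i) (F.coord i V) (geo i).eta))
    (conjHom b (gradLin (F.T i) ((((geo i).eta : ℂ))⁻¹) (F.coord i V)) ∘ₗ
        (1 - (F.Gop i V ∘ₗ F.Qcs i V ∘ₗ F.Cop i V ∘ₗ F.Qc i V ∘ₗ F.Gop i V)) ∘ₗ
      conjHom b (divLin (F.T i) ((((geo i).eta : ℂ))⁻¹) (F.coord i V))) (F.Qsb i V) (F.ab i) (F.Qb i V)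

omit [DecidableEq ι] [∀ i, DecidableEq (S i)] [∀ i, Nonempty (geo i).Site] in
/-- `reg_ginv` in terms of `GFrame.DeltaA`. [cite: Balaban1985BackgroundPropagators, Thm 3.3 p.399 + Thm 3.11 p.416] -/
theorem GFrame.deltaA_mul_gb {GA : ∀ i, B9.KernelFamily (geo i) (bg i)} {Cinv : ∀ i, B9.SiteKernel (geo i) (bg i)}
    (F : GFrame c35 geo bg Gp b κ S GA Cinv) (i : I) (α₀ : ℝ) (U : (bg i).Cfg) (hM : F.MInv ≤ (geo i).M) (hα₀ : 0 < α₀)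
    (hMa : (geo i).M * α₀ ≤ F.aInv) (hU : (bg i).Reg335 c35 α₀ U) :
    F.DeltaA i U * F.Gb i U = 1 ∧ F.Gb i U * F.DeltaA i U = 1 :=
  F.reg_ginv i α₀ U hM hα₀ hMa hU

omit [DecidableEq ι] [∀ i, DecidableEq (S i)] [∀ i, Nonempty (geo i).Site] in
/-- `gb_eq` in terms of `GFrame.DeltaA`: G(V) is the unique two-sided inverse of Δ_a(V). [cite: Balaban1985BackgroundPropagators, (3.30) p.395] -/
theorem GFrame.gb_eq_of_inv {GA : ∀ i, B9.KernelFamily (geo i) (bg i)} {Cinv : ∀ i, B9.SiteKernel (geo i) (bg i)}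
    (F : GFrame c35 geo bg Gp b κ S GA Cinv) (i : I) (V : (bg i).Cfg) (X : Module.End ℝ ((κ × S i) × ι → ℝ))
    (h1 : F.DeltaA i V * X = 1) (h2 : X * F.DeltaA i V = 1) : F.Gb i V = X :=
  F.gb_eq i V _ X rfl h1 h2

/-! ## ★ The (3.42) entries of G(U′U) at the letters, the (3.42)-step and the (3.47)-step -/

/-- **The (3.42) entries of G(U′U) at the letters** — the common core of the (3.42)- and (3.47)-steps for the bond-sector
family: for every input `(B₀, δ₀, B₁, δ₁) > 0` there are `a₁ > 0`, `B ≧ 0` (before the member) such that at every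
(3.35)-regular U above the thresholds with the (3.42) blocks of `Gp` and `GA` at (B₀, δ₀) and the (3.48) kernel of `Cinv` at
(B₁, δ₁), and every U′ in (3.37) at α₁ ≦ a₁, the family's `G(U′U)` carries the four majorants (entry, left differences, right
differences, Laplacian letter) at `(B, δr/6)`, `δr = min(min(δ₀, δ₁), δcap)`, and inverts the frame's Δ_a(U′U) word
`F.DeltaA i (U′U)` on both sides (the analytic-extension clause).  Proof = r06's `thm34_G_clause_uniform` at δr (all
inputs lowered to it); `thm34_Gp_uniform` for the inverse identities of the G′ extension; then three uniqueness identifications —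
the family's G′(U′U) IS r06's extension (`gop_eq` ∘ `mul_law`), its C⁻¹(U′U) IS r06's `Tinv` (`cop_eq`, (3.57) `q_mul`), and, after
the section identity `rZero_add_pPrime_sections` and `coord_mul`, its G(U′U) IS r06's `GExt` (`gb_eq`, (3.80) `qb_mul`).
[cite: Balaban1985BackgroundPropagators, Thm 3.4 p.400 + Thm 3.3 p.399 + (3.80)–(3.86) p.407 + (3.68) p.403 + (3.57)–(3.65) p.402 + Thm 3.1 (3.42) p.397 + Thm 3.11 p.416; Balaban1984PropagatorsII, Lemma 2.1 (2.61) p.234] -/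
theorem entries342_ext_of_gFrame {GA : ∀ i, B9.KernelFamily (geo i) (bg i)} {Cinv : ∀ i, B9.SiteKernel (geo i) (bg i)}
    (F : GFrame c35 geo bg Gp b κ S GA Cinv) {B₀ δ₀ B₁ δ₁ : ℝ} (hB₀ : 0 < B₀) (hδ₀ : 0 < δ₀) (hB₁ : 0 < B₁) (hδ₁ : 0 < δ₁) :
    ∃ a₁ : ℝ, 0 < a₁ ∧ ∃ B : ℝ, 0 ≤ B ∧
      ∀ (i : I) (α₀ : ℝ) (U : (bg i).Cfg), F.MInv ≤ (geo i).M → 0 < α₀ → (geo i).M * α₀ ≤ F.aInv →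
        (bg i).Reg335 c35 α₀ U → EBlock (Gp i) B₀ δ₀ U →
        (∀ y y' : (geo i).Site, |(Cinv i).ker U y y'| ≤
          B₁ * ((geo i).len y) ^ (-(4 : ℝ)) * ((geo i).len y') ^ (-(F.dB : ℝ)) * Real.exp (-(δ₁ * (geo i).dist y y'))) →
        EBlock (GA i) B₀ δ₀ U →
        ∀ (α₁ : ℝ) (U' : (bg i).Cfg), 0 < α₁ → α₁ ≤ a₁ → (bg i).Cplx337 α₁ U U' →
          (F.DeltaA i ((bg i).mul U' U) * F.Gb i ((bg i).mul U' U) = 1 ∧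
            F.Gb i ((bg i).mul U' U) * F.DeltaA i ((bg i).mul U' U) = 1) ∧
          HasMajorant (g := toB6 (geo i) (F.Rr i) (F.Hp i)) (fun q : (κ × S i) × ι => F.blk i q.1.2) (F.Gb i ((bg i).mul U' U))
              (fun a a' => B * (geo i).len a ^ 2 * Real.exp (-(min (min δ₀ δ₁) F.δcap / 6 * (geo i).dist a a'))) ∧
            (∀ k : κ ⊕ κ, HasMajorant (g := toB6 (geo i) (F.Rr i) (F.Hp i)) (fun q : (κ × S i) × ι => F.blk i q.1.2)
              (conj b (diffLetter (bT (F.T i)) (bU (F.coord i U)) ((((geo i).eta : ℂ))⁻¹) k) * F.Gb i ((bg i).mul U' U))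
              (fun a a' => B * (geo i).len a * Real.exp (-(min (min δ₀ δ₁) F.δcap / 6 * (geo i).dist a a')))) ∧
            (∀ k : κ ⊕ κ, HasMajorant (g := toB6 (geo i) (F.Rr i) (F.Hp i)) (fun q : (κ × S i) × ι => F.blk i q.1.2)
              (F.Gb i ((bg i).mul U' U) * conj b (diffLetter (bT (F.T i)) (bU (F.coord i U)) ((((geo i).eta : ℂ))⁻¹) k))
              (fun a a' => B * (geo i).len a * Real.exp (-(min (min δ₀ δ₁) F.δcap / 6 * (geo i).dist a a')))) ∧
            HasMajorant (g := toB6 (geo i) (F.Rr i) (F.Hp i)) (fun q : (κ × S i) × ι => F.blk i q.1.2)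
              (F.LapB i U * F.Gb i ((bg i).mul U' U))
              (fun a a' => B * 1 * Real.exp (-(min (min δ₀ δ₁) F.δcap / 6 * (geo i).dist a a'))) := by
  classical
  -- the common rate of the call
  have hδr : 0 < min (min δ₀ δ₁) F.δcap := lt_min (lt_min hδ₀ hδ₁) F.δcap_pos
  have hδr0 : min (min δ₀ δ₁) F.δcap ≤ δ₀ := le_trans (min_le_left _ _) (min_le_left _ _)
  have hδr1 : min (min δ₀ δ₁) F.δcap ≤ δ₁ := le_trans (min_le_left _ _) (min_le_right _ _)
  have hδrc : min (min δ₀ δ₁) F.δcap ≤ F.δcap := min_le_right _ _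
  have hBG : 0 < F.cR * B₀ := mul_pos F.cR_pos hB₀
  have hBb : 0 < F.cRG * B₀ := mul_pos F.cRG_pos hB₀
  have hBK : 0 < F.cK * B₁ := mul_pos F.cK_pos hB₁
  -- r06's uniform Theorem-3.4 clauses: G′ (for the inverse identities of the extension) and G
  obtain ⟨a₁, ha₁, B', -, H'⟩ := thm34_Gp_uniform b κ F.dB (min (min δ₀ δ₁) F.δcap) (F.cR * B₀) F.Cq F.a₀ F.d₀ F.M₂
    (F.Λf (min (min δ₀ δ₁) F.δcap)) hBG F.Cq_nonneg F.a₀_nonneg F.M₂_nonneg hδr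
    (fun α hα => F.Λf_one_le _ α hδr hα) F.hrepr
  obtain ⟨a₂, ha₂, B, hB, H⟩ := thm34_G_clause_uniform b κ F.dB (min (min δ₀ δ₁) F.δcap) (F.cRG * B₀) F.κQ (F.cR * B₀)
    (F.cK * B₁) F.cF F.Cq F.a₀ F.C₀ F.d₀ F.M₂ F.κQb F.cFb F.abar (F.Λf (min (min δ₀ δ₁) F.δcap)) hBb.le F.κQ_pos hBG hBK
    F.cF_pos F.Cq_nonneg F.a₀_nonneg F.C₀_nonneg F.M₂_nonneg hδr F.κQb_nonneg F.cFb_nonneg F.abar_nonneg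
    (fun α hα => F.Λf_one_le _ α hδr hα) F.hrepr
  refine ⟨min a₁ a₂, lt_min ha₁ ha₂, B, hB, ?_⟩
  intro i α₀ U hM hα₀ hMa hU hEp hKer hEG α₁ U' hα₁ ha hU'
  have ha1 : α₁ ≤ a₁ := le_trans ha (min_le_left _ _)
  have ha2 : α₁ ≤ a₂ := le_trans ha (min_le_right _ _)
  -- the site-sector letters at U: G′(U) inverts Δ′_a(U); (3.42)₀,₁,₂ of G′ at δ₀ lowered to δr
  obtain ⟨hΔG, hGΔ⟩ := F.reg_inv i α₀ U hM hα₀ hMa hU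
  obtain ⟨h1, h2, h3, -⟩ := F.read342 i α₀ U B₀ δ₀ hM hα₀ hMa hU hB₀ hδ₀ hEp
  have hc2 : ∀ a : (geo i).Site, 0 ≤ F.cR * B₀ * (geo i).len a ^ 2 := fun a => mul_nonneg hBG.le (sq_nonneg _)
  have hc1 : ∀ a : (geo i).Site, 0 ≤ F.cR * B₀ * (geo i).len a := fun a => mul_nonneg hBG.le (F.len_pos i a).le
  have h1' := hasMajorant_rate_le (g := toB6 (geo i) (F.Rr i) (F.Hp i)) (fun p : S i × ι => F.blk i p.1)
    (fun a => (geo i).len a ^ 2) hc2 hδr0 (F.dist_nonneg i) h1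
  have h2' := fun k => hasMajorant_rate_le (g := toB6 (geo i) (F.Rr i) (F.Hp i)) (fun p : S i × ι => F.blk i p.1)
    (fun a => (geo i).len a) hc1 hδr0 (F.dist_nonneg i) (h2 k)
  have h3' := fun k => hasMajorant_rate_le (g := toB6 (geo i) (F.Rr i) (F.Hp i)) (fun p : S i × ι => F.blk i p.1)
    (fun a => (geo i).len a) hc1 hδr0 (F.dist_nonneg i) (h3 k)
  -- the (3.48) kernel of C⁻¹(U) at δ₁ lowered to δr
  have hK := F.readKer i α₀ U B₁ δ₁ hM hα₀ hMa hU hB₁ hδ₁ hKer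
  have hK' : ∀ y y' : (geo i).Site, |B9Thm34Inv.ker (B9Thm34Inv.vol (geo i) F.dB) (F.Cop i U) y y'| ≤
      F.cK * B₁ * (geo i).len y ^ (-(4 : ℝ)) * (geo i).len y' ^ (-(F.dB : ℝ)) *
        Real.exp (-(min (min δ₀ δ₁) F.δcap * (geo i).dist y y')) := by
    intro y y'
    refine (hK y y').trans (mul_le_mul_of_nonneg_left (Real.exp_le_exp.2 ?_) ?_)
    · nlinarith [F.dist_nonneg i y y', hδr1]
    · exact mul_nonneg (mul_nonneg hBK.le (Real.rpow_nonneg (F.len_pos i y).le _))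
        (Real.rpow_nonneg (F.len_pos i y').le _)
  -- the bond-sector letters at U: G(U) inverts Δ_a(U); (3.42) of G at δ₀ lowered to δr; (3.15) sizes at δr
  obtain ⟨hΔGb, hGbΔ⟩ := F.reg_ginv i α₀ U hM hα₀ hMa hU
  obtain ⟨g1, g2, g3, -⟩ := F.readG342 i α₀ U B₀ δ₀ hM hα₀ hMa hU hB₀ hδ₀ hEG
  have hb2 : ∀ a : (geo i).Site, 0 ≤ F.cRG * B₀ * (geo i).len a ^ 2 := fun a => mul_nonneg hBb.le (sq_nonneg _)
  have hb1 : ∀ a : (geo i).Site, 0 ≤ F.cRG * B₀ * (geo i).len a := fun a => mul_nonneg hBb.le (F.len_pos i a).le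
  have g1' := hasMajorant_rate_le (g := toB6 (geo i) (F.Rr i) (F.Hp i)) (fun q : (κ × S i) × ι => F.blk i q.1.2)
    (fun a => (geo i).len a ^ 2) hb2 hδr0 (F.dist_nonneg i) g1
  have g2' := fun k => hasMajorant_rate_le (g := toB6 (geo i) (F.Rr i) (F.Hp i)) (fun q : (κ × S i) × ι => F.blk i q.1.2)
    (fun a => (geo i).len a) hb1 hδr0 (F.dist_nonneg i) (g2 k)
  have g3' := fun k => hasMajorant_rate_le (g := toB6 (geo i) (F.Rr i) (F.Hp i)) (fun q : (κ × S i) × ι => F.blk i q.1.2)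
    (fun a => (geo i).len a) hb1 hδr0 (F.dist_nonneg i) (g3 k)
  have hQb := F.hQb i U _ hδr hδrc
  have hQsb := F.hQsb i U _ hδr hδrc
  -- the class (3.37) read blockwise; the (3.57), (3.80)–(3.81) letters; (3.35) on plaquettes
  obtain ⟨hkF, hsF, h337B, h337F, h337Bτ, hA, hAτB⟩ := F.cplx i α₁ U U' hα₁ hU'
  obtain ⟨h337B', h337FB, hAτF, hAFB, hAst, hAloc, hdAst⟩ := F.cplxG i α₁ U U' hα₁ hU'
  obtain ⟨hQm, hQsm⟩ := F.q_mul i α₁ U U' hα₁ hU'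
  obtain ⟨hFc, hFcs⟩ := F.hF i α₁ U U' hα₁ hU'
  obtain ⟨hQbm, hQsbm⟩ := F.qb_mul i α₁ U U' hα₁ hU'
  obtain ⟨hF₂, hF₂s⟩ := F.hF₂ i α₁ U U' hα₁ hU' _ hδr hδrc
  have h35 := F.reg335 i α₀ U hM hα₀ hMa hU
  -- the G′ clause: the inverse identities of the extension ⇒ the family's G′(U′U) is r06's extension
  obtain ⟨hinv1, hinv2, -, -⟩ := H' (F.T i) (F.coord i U) (F.blk i) (F.kQ i U) (F.sQ i U) (F.cfun i) (F.w i U)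
    (F.dist_nonneg i) (F.triangle i) (F.dist_self i) (F.dist_comm i) (F.len_pos i) (F.eta_le_len i) (F.eta_pos i)
    (fun α hα hα1 => F.h261 i _ α hδr hα hα1) (fun α hα => F.hST i _ α hδr hα) (F.unitary i U)
    (F.stencilB i) (F.stencilF i) (F.stencil0 i) (F.w_nonneg i U) (F.card_w i U) (F.hkQ i U) (F.hsQ i U) (F.hcfun i)
    hΔG hGΔ h1' h2' h3' α₁ hα₁.le ha1 (F.expA i U U') (F.kF i U U') (F.sF i U U')
    hkF hsF h337B h337F h337Bτ hA hAτB
  have hGp := F.gop_eq i ((bg i).mul U' U) _ _ (F.mul_law i α₁ U U' hα₁ hU') hinv1 hinv2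
  -- the G clause
  obtain ⟨Tinv, GExt, hT1, hT2, hG1, hG2, hleft, hright⟩ := H (F.T i) (F.coord i U) (F.blk i) (F.kQ i U) (F.sQ i U)
    (F.cfun i) (F.w i U)
    (F.dist_nonneg i) (F.triangle i) (F.dist_self i) (F.dist_comm i) (F.len_pos i) (F.eta_le_len i) (F.eta_pos i)
    (F.L_one_le i) (fun α hα hα1 => F.h261 i _ α hδr hα hα1) (fun α hα => F.hST i _ α hδr hα) (F.T_comm i)
    (F.unitary i U) h35 (F.stencilB i) (F.stencilF i) (F.stencilFB i) (F.stencilSt i) (F.stencilLoc i) (F.stencil0 i)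
    (F.w_nonneg i U) (F.card_w i U) (F.hkQ i U) (F.hsQ i U) (F.hcfun i)
    h1' h2' h3' (F.rep i) (F.hrep i) (F.hQc i U) (F.hQcs i U) (F.reg_cinv i α₀ U hM hα₀ hMa hU) hK'
    hQb hQsb (F.ha324 i) hΔGb hGbΔ g1' g2' g3' α₁ hα₁.le ha2 (F.expA i U U') (F.kF i U U') (F.sF i U U')
    hkF hsF h337B h337F h337B' h337Bτ h337FB hA hAτB hAτF hAFB hAst hAloc hdAst hQm hQsm hFc hFcs hQbm hQsbm rfl hF₂ hF₂s
  -- (1) G′(U′U) = r06's extension; (2) C⁻¹(U′U) = r06's Tinv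
  rw [← hGp] at hT1 hT2 hG1 hG2
  have hC := F.cop_eq i ((bg i).mul U' U) _ Tinv rfl hT1 hT2
  rw [← hC] at hG1 hG2
  -- (3) the section identity: R₀ + P′(A) through `rep` is P(U′U) read directly; (4) the background of U′U
  have hinj : Function.Injective (F.rep i) := fun y₁ y₂ h => by
    have e := congrArg (fun p : S i × ι => F.blk i p.1) h
    simpa only [F.hrep] using e
  rw [rZero_add_pPrime_sections hinj, ← F.coord_mul i α₁ U U' hα₁ hU'] at hG1 hG2
  -- (5) G(U′U) = r06's GExt
  have hGb := F.gb_eq i ((bg i).mul U' U) _ GExt rfl hG1 hG2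
  rw [← hGb] at hleft hright hG1 hG2
  -- (6) the four entries of G(U′U) at (B, δr/6)
  have g1'' : HasMajorant (g := toB6 (geo i) (F.Rr i) (F.Hp i)) (fun q : (κ × S i) × ι => F.blk i q.1.2)
      (1 * F.Gb i U)
      (fun a a' => F.cRG * B₀ * (geo i).len a ^ 2 * Real.exp (-(min (min δ₀ δ₁) F.δcap * (geo i).dist a a'))) := by
    rw [one_mul]; exact g1'
  have e0 : HasMajorant (g := toB6 (geo i) (F.Rr i) (F.Hp i)) (fun q : (κ × S i) × ι => F.blk i q.1.2)
      (1 * F.Gb i ((bg i).mul U' U))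
      (fun a a' => B * (geo i).len a ^ 2 * Real.exp (-(min (min δ₀ δ₁) F.δcap / 6 * (geo i).dist a a'))) :=
    hleft 1 (fun a => (geo i).len a ^ 2) (fun a => sq_nonneg _) g1''
  rw [one_mul] at e0
  -- the Laplacian letter entry, read at δ₀ and lowered
  obtain ⟨-, -, -, gL⟩ := F.readG342 i α₀ U B₀ δ₀ hM hα₀ hMa hU hB₀ hδ₀ hEG
  have hb0 : ∀ _a : (geo i).Site, 0 ≤ F.cRG * B₀ * 1 := fun _ => mul_nonneg hBb.le zero_le_one
  have gL' := hasMajorant_rate_le (g := toB6 (geo i) (F.Rr i) (F.Hp i)) (fun q : (κ × S i) × ι => F.blk i q.1.2)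
    (fun _ => (1 : ℝ)) hb0 hδr0 (F.dist_nonneg i) gL
  exact ⟨⟨hG1, hG2⟩, e0, fun k => hleft _ (fun a => (geo i).len a) (fun a => (F.len_pos i a).le) (g2' k),
    fun k => hright _ (g3' k), hleft _ (fun _ => (1 : ℝ)) (fun _ => zero_le_one) gL'⟩

/-- ★ **THE (3.42)-STEP OF SECT. B FOR G(U′U), INHABITED AT THE LETTERS**: every letters dictionary `GFrame` for the bond-sector
family `GA` inhabits the positive-input block-step `B9SectBStepWhole.StepEPos F.dB c35 geo bg Gp GA Cinv GA` (kernel exponent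
of the input tuple = the frame's dimension `dB`), by `entries342_ext_of_gFrame` and the frame's (3.42) writing.  Thresholds:
M ≧ MInv, Mα₀ ≦ aInv, α₁ ≦ min(a₁, aW); output constants `(wBG B (δr/6), wδG (δr/6))`, `δr = min(min(δ₀, δ₁), δcap)`.  Nothing of
print asserted beyond what r06's theorems prove. [cite: Balaban1985BackgroundPropagators, Thm 3.4 p.400 + Thm 3.3 p.399 + (3.80)–(3.86) p.407 + Thm 3.1 (3.42) p.397] -/
theorem stepEPos_of_gFrame {GA : ∀ i, B9.KernelFamily (geo i) (bg i)} {Cinv : ∀ i, B9.SiteKernel (geo i) (bg i)}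
    (F : GFrame c35 geo bg Gp b κ S GA Cinv) :
    StepEPos F.dB c35 geo bg Gp GA Cinv GA := by
  intro B₀ δ₀ Bβ Bε Bεβ B₁ δ₁ hB₀ hδ₀ hB₁ hδ₁
  obtain ⟨a₁, ha₁, B, hB, H⟩ := entries342_ext_of_gFrame F hB₀ hδ₀ hB₁ hδ₁
  have hδ6 : 0 < min (min δ₀ δ₁) F.δcap / 6 := by
    have hδr : 0 < min (min δ₀ δ₁) F.δcap := lt_min (lt_min hδ₀ hδ₁) F.δcap_pos
    positivity
  refine ⟨F.MInv, min a₁ F.aW, F.aInv, (F.wBG B (min (min δ₀ δ₁) F.δcap / 6), F.wδG (min (min δ₀ δ₁) F.δcap / 6)),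
    F.MInv_pos, lt_min ha₁ F.aW_pos, F.aInv_pos, ⟨F.wBG_pos B _ hB hδ6, F.wδG_pos _ hδ6⟩, ?_⟩
  intro i hM α₀ hα₀ hMa U hU hT α₁ hα₁ ha U' hU'
  obtain ⟨-, e0, e1, e2, e3⟩ := H i α₀ U hM hα₀ hMa hU hT.1.1.1 hT.2.1 hT.2.2.1.1 α₁ U' hα₁
    (le_trans ha (min_le_left _ _)) hU'
  exact F.writeG342 i U U' α₁ B _ hα₁ (le_trans ha (min_le_right _ _)) hU' hB hδ6 e0 e1 e2 e3

/-! ## The (3.47) global block of G(U′U) at the letters -/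

variable (c35 geo bg Gp b κ S) in
/-- **THE LETTERS DICTIONARY FOR THE GLOBAL BLOCK (3.47) OF G** — `GFrame` plus the writing of the four (3.42)-type majorants of
`G(U′U)` as the (3.47) block of the family `GA` at U′U (the instance's (3.47)-from-(3.42) reading, p. 398 *"the global
inequalities (3.47) are consequences of the local ones (3.42) and Lemma 2.1"*, at the letters `B9Ineq347AllEntries` on the bond
carrier; writing function `wGG`).  A hypothesis structure; nothing asserted.
[cite: Balaban1985BackgroundPropagators, (3.47) p.398 + Thm 3.3 p.399 + p.407; Balaban1984PropagatorsII, Lemma 2.1 p.234] -/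
structure GlobGFrame (GA : ∀ i, B9.KernelFamily (geo i) (bg i)) (Cinv : ∀ i, B9.SiteKernel (geo i) (bg i))
    extends GFrame c35 geo bg Gp b κ S GA Cinv where
  wGG : ℝ → ℝ → ℝ
  wGG_pos : ∀ B δ : ℝ, 0 ≤ B → 0 < δ → 0 < wGG B δ
  /-- WRITING (3.47): the four majorants of G(U′U) at (B, δ) ⇒ the (3.47) block of `GA` at U′U with constant `wGG B δ`. -/
  writeGlobG : ∀ i (U U' : (bg i).Cfg) (α₁ B δ : ℝ), 0 < α₁ → α₁ ≤ aW → (bg i).Cplx337 α₁ U U' → 0 ≤ B → 0 < δ →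
    HasMajorant (g := toB6 (geo i) (Rr i) (Hp i)) (fun q : (κ × S i) × ι => blk i q.1.2) (Gb i ((bg i).mul U' U))
        (fun a a' => B * (geo i).len a ^ 2 * Real.exp (-(δ * (geo i).dist a a'))) →
    (∀ k : κ ⊕ κ, HasMajorant (g := toB6 (geo i) (Rr i) (Hp i)) (fun q : (κ × S i) × ι => blk i q.1.2)
        (conj b (diffLetter (bT (T i)) (bU (coord i U)) ((((geo i).eta : ℂ))⁻¹) k) * Gb i ((bg i).mul U' U))
        (fun a a' => B * (geo i).len a * Real.exp (-(δ * (geo i).dist a a')))) →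
    (∀ k : κ ⊕ κ, HasMajorant (g := toB6 (geo i) (Rr i) (Hp i)) (fun q : (κ × S i) × ι => blk i q.1.2)
        (Gb i ((bg i).mul U' U) * conj b (diffLetter (bT (T i)) (bU (coord i U)) ((((geo i).eta : ℂ))⁻¹) k))
        (fun a a' => B * (geo i).len a * Real.exp (-(δ * (geo i).dist a a')))) →
    HasMajorant (g := toB6 (geo i) (Rr i) (Hp i)) (fun q : (κ × S i) × ι => blk i q.1.2)
        (LapB i U * Gb i ((bg i).mul U' U)) (fun a a' => B * 1 * Real.exp (-(δ * (geo i).dist a a'))) →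
    B9FromB6.GlobBlock (GA i) (wGG B δ) ((bg i).mul U' U)

/-- ★ **THE (3.47)-STEP OF SECT. B FOR G(U′U), INHABITED AT THE LETTERS**: every `GlobGFrame` inhabits
`B9SectBStepWhole.StepGlobPos F.dB c35 geo bg Gp GA Cinv GA` (output constant `wGG B (δr/6)`), by `entries342_ext_of_gFrame` and
the frame's (3.47) writing. [cite: Balaban1985BackgroundPropagators, Thm 3.4 p.400 + (3.47) p.398 + Thm 3.3 p.399 + p.407] -/
theorem stepGlobPos_of_globGFrame {GA : ∀ i, B9.KernelFamily (geo i) (bg i)} {Cinv : ∀ i, B9.SiteKernel (geo i) (bg i)}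
    (F : GlobGFrame c35 geo bg Gp b κ S GA Cinv) :
    B9SectBStepWhole.StepGlobPos F.dB c35 geo bg Gp GA Cinv GA := by
  intro B₀ δ₀ Bβ Bε Bεβ B₁ δ₁ hB₀ hδ₀ hB₁ hδ₁
  obtain ⟨a₁, ha₁, B, hB, H⟩ := entries342_ext_of_gFrame F.toGFrame hB₀ hδ₀ hB₁ hδ₁
  have hδ6 : 0 < min (min δ₀ δ₁) F.δcap / 6 := by
    have hδr : 0 < min (min δ₀ δ₁) F.δcap := lt_min (lt_min hδ₀ hδ₁) F.δcap_pos
    positivity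
  refine ⟨F.MInv, min a₁ F.aW, F.aInv, F.wGG B (min (min δ₀ δ₁) F.δcap / 6), F.MInv_pos, lt_min ha₁ F.aW_pos, F.aInv_pos,
    F.wGG_pos B _ hB hδ6, ?_⟩
  intro i hM α₀ hα₀ hMa U hU hT α₁ hα₁ ha U' hU'
  obtain ⟨-, e0, e1, e2, e3⟩ := H i α₀ U hM hα₀ hMa hU hT.1.1.1 hT.2.1 hT.2.2.1.1 α₁ U' hα₁
    (le_trans ha (min_le_left _ _)) hU'
  exact F.writeGlobG i U U' α₁ B _ hα₁ (le_trans ha (min_le_right _ _)) hU' hB hδ6 e0 e1 e2 e3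


/-! ## The analytic-extension step for G at the letters (13-An, G half) -/

variable (c35 geo bg Gp b κ S) in
/-- **THE LETTERS DICTIONARY FOR THE ANALYTIC EXTENSION OF G** — `GFrame` plus ONE field: at a (3.35)-regular U above the
thresholds and 0 < α₁ ≦ aW, if the frame's Δ_a(U′U) word `DeltaA i (U′U)` is inverted on both sides by the family's own G(U′U) for
EVERY U′ in the class (3.37) at α₁, then the layer's predicate `IsAnalyticExt i (GA i) U α₁` holds (instance: matrix inverse is
analytic in A on a finite lattice, cf. `B9Eq386NeumannAnalytic`).  A hypothesis structure; nothing asserted.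
[cite: Balaban1985BackgroundPropagators, Thm 3.4 p.400 + (3.84)–(3.86) p.407] -/
structure AnGFrame (GA : ∀ i, B9.KernelFamily (geo i) (bg i)) (Cinv : ∀ i, B9.SiteKernel (geo i) (bg i))
    (IsAnalyticExt : ∀ i, B9.KernelFamily (geo i) (bg i) → (bg i).Cfg → ℝ → Prop)
    extends GFrame c35 geo bg Gp b κ S GA Cinv where
  writeAnG : ∀ i (α₀ : ℝ) (U : (bg i).Cfg) (α₁ : ℝ), MInv ≤ (geo i).M → 0 < α₀ → (geo i).M * α₀ ≤ aInv →
    (bg i).Reg335 c35 α₀ U → 0 < α₁ → α₁ ≤ aW →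
    (∀ U' : (bg i).Cfg, (bg i).Cplx337 α₁ U U' →
      deltaA (conj b (lapDDLetter (T i) ((((geo i).eta : ℂ))⁻¹) (coord i ((bg i).mul U' U))))
          (conj b (dPrimeLetter (T i) (coord i ((bg i).mul U' U)) (geo i).eta))
          (conjHom b (gradLin (T i) ((((geo i).eta : ℂ))⁻¹) (coord i ((bg i).mul U' U))) ∘ₗ
              (1 - (Gop i ((bg i).mul U' U) ∘ₗ Qcs i ((bg i).mul U' U) ∘ₗ Cop i ((bg i).mul U' U) ∘ₗ
                Qc i ((bg i).mul U' U) ∘ₗ Gop i ((bg i).mul U' U))) ∘ₗ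
            conjHom b (divLin (T i) ((((geo i).eta : ℂ))⁻¹) (coord i ((bg i).mul U' U))))
          (Qsb i ((bg i).mul U' U)) (ab i) (Qb i ((bg i).mul U' U)) * Gb i ((bg i).mul U' U) = 1 ∧
      Gb i ((bg i).mul U' U) *
        deltaA (conj b (lapDDLetter (T i) ((((geo i).eta : ℂ))⁻¹) (coord i ((bg i).mul U' U))))
          (conj b (dPrimeLetter (T i) (coord i ((bg i).mul U' U)) (geo i).eta))
          (conjHom b (gradLin (T i) ((((geo i).eta : ℂ))⁻¹) (coord i ((bg i).mul U' U))) ∘ₗ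
              (1 - (Gop i ((bg i).mul U' U) ∘ₗ Qcs i ((bg i).mul U' U) ∘ₗ Cop i ((bg i).mul U' U) ∘ₗ
                Qc i ((bg i).mul U' U) ∘ₗ Gop i ((bg i).mul U' U))) ∘ₗ
            conjHom b (divLin (T i) ((((geo i).eta : ℂ))⁻¹) (coord i ((bg i).mul U' U))))
          (Qsb i ((bg i).mul U' U)) (ab i) (Qb i ((bg i).mul U' U)) = 1) →
    IsAnalyticExt i (GA i) U α₁

/-- ★ **THE ANALYTIC-EXTENSION STEP OF SECT. B FOR G, INHABITED AT THE LETTERS**: every `AnGFrame` inhabits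
`B9SectBStepWhole.StepAnalyticPos1 F.dB c35 geo bg Gp GA Cinv IsAnalyticExt GA` (the G half of `StepAnalyticPos`; the G′ half is
`B9SectBGpStepAtLettersAn.stepAnalyticPos1_of_anFrame`, merged by `B9SectBStepWhole.stepAnalyticPos_of_halves`).  Proof: the
inverse identities of `entries342_ext_of_gFrame` for every U′ in the class at α₁ ≦ min(a₁, aW), then `writeAnG`.
[cite: Balaban1985BackgroundPropagators, Thm 3.4 p.400 + (3.84)–(3.86) p.407] -/
theorem stepAnalyticPos1_of_anGFrame {GA : ∀ i, B9.KernelFamily (geo i) (bg i)} {Cinv : ∀ i, B9.SiteKernel (geo i) (bg i)}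
    {IsAnalyticExt : ∀ i, B9.KernelFamily (geo i) (bg i) → (bg i).Cfg → ℝ → Prop}
    (F : AnGFrame c35 geo bg Gp b κ S GA Cinv IsAnalyticExt) :
    B9SectBStepWhole.StepAnalyticPos1 F.dB c35 geo bg Gp GA Cinv IsAnalyticExt GA := by
  intro B₀ δ₀ Bβ Bε Bεβ B₁ δ₁ hB₀ hδ₀ hB₁ hδ₁
  obtain ⟨a₁, ha₁, B, -, H⟩ := entries342_ext_of_gFrame F.toGFrame hB₀ hδ₀ hB₁ hδ₁
  refine ⟨F.MInv, min a₁ F.aW, F.aInv, PUnit.unit, F.MInv_pos, lt_min ha₁ F.aW_pos, F.aInv_pos, trivial, ?_⟩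
  intro i hM α₀ hα₀ hMa U hU hT α₁ hα₁ ha
  refine F.writeAnG i α₀ U α₁ hM hα₀ hMa hU hα₁ (le_trans ha (min_le_right _ _)) fun U' hU' => ?_
  exact (H i α₀ U hM hα₀ hMa hU hT.1.1.1 hT.2.1 hT.2.2.1.1 α₁ U' hα₁ (le_trans ha (min_le_left _ _)) hU').1

/-! ## The L² members (3.46)₁,₂,₃,₅ of G(U′U) at the letters — WITH THE KERNEL-FORM INPUT DISPLAYED

As for G′ (`B9SectBGpStepAtLetters.L2Frame`, LOCATED-3 of seat `pub-ymgap-dag-n06-c` g2): the tree's L² transfer for the bond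
sector, `B9Ineq346L2Uniform.thm34_G_l2_uniform`, takes THEOREM 3.3 FOR G(U) IN THE PRINTED KERNEL FORM ([4] (2.64)–(2.66),
`B6RandomWalkKernel.HasKernelBound` on the bond carrier) as input (Schur's test on block pairs), which the cell's sup readings
`B9.KernelFamily.e` do not carry.  The frame below therefore carries it as a NAMED LAW `kerG` — «Theorem 3.3 (3.42)₁₋₄ for the
family's G(U) in kernel form at every (3.35)-regular U above the thresholds, frame-level constants (B_KG, δ_KG)» — N06 CONTENT
(in print: the random-walk expansion (3.107) with the kernel bounds of the local propagators), NOT a reading; everything else is a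
reading (block volumes `vG` in the kernel pairing p. 393, [4] Lemma 2.1 for `vG^{−1/2}`, the L² writing for the members
n ∈ {0, 1, 2, 4} of `B9.pref6`; the two-difference members ₄,₆ want sibling frames over `B9Ineq346L2SecondDiffUniform` ∕
`B9Ineq346L2RightDiffGUniform`). -/

/-- Profile bookkeeping: `c·p·e^{−δd} ≦ c′·p·e^{−δ′d}` for `c ≦ c′`, `0 ≦ c′`, `δ′ ≦ δ`, `p, d ≧ 0`. [folklore] -/
private theorem prof_le {c c' δ δ' d p : ℝ} (hp : 0 ≤ p) (hc : c ≤ c') (hc' : 0 ≤ c') (hδ : δ' ≤ δ) (hd : 0 ≤ d) :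
    c * p * Real.exp (-(δ * d)) ≤ c' * p * Real.exp (-(δ' * d)) :=
  mul_le_mul (mul_le_mul_of_nonneg_right hc hp) (Real.exp_le_exp.2 (by nlinarith)) (Real.exp_nonneg _) (mul_nonneg hc' hp)

variable (c35 geo bg Gp b κ S) in
/-- **THE KERNEL-FORM LAW FOR G** — `GFrame` plus the block-volume weights `vG i` of the bond carrier in the kernel pairing of p. 393
(constant `cKvG`) and ★ the NAMED LAW `kerG` = Theorem 3.3 (3.42)₁₋₄ for the family's G(U) IN THE PRINTED KERNEL FORM at
(3.35)-regular U above the thresholds (frame-level constants `BKG, δKG`; N06 content, see the section note) — the common input of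
r06's L² and Hölder transfers for the bond sector (`B9Ineq346L2Uniform.thm34_G_l2_uniform`, `B9Thm34HolderAllUniform`,
`B9Thm34HolderInputGUniform`).  A hypothesis structure; nothing asserted.
[cite: Balaban1985BackgroundPropagators, Thm 3.3 p.399 + (3.42) p.397 + p.393; Balaban1984PropagatorsII, (2.64)–(2.66) p.234] -/
structure KerGFrame (GA : ∀ i, B9.KernelFamily (geo i) (bg i)) (Cinv : ∀ i, B9.SiteKernel (geo i) (bg i))
    extends GFrame c35 geo bg Gp b κ S GA Cinv where
  cKvG : ℝ
  BKG : ℝ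
  δKG : ℝ
  cKvG_pos : 0 < cKvG
  BKG_pos : 0 < BKG
  δKG_pos : 0 < δKG
  vG : ∀ i, (geo i).Site → ℝ
  vG_pos : ∀ i (y : (geo i).Site), 0 < vG i y
  /-- ★ THE NAMED LAW (N06 content, NOT a reading): Theorem 3.3 (3.42)₁₋₄ for G(U) in the printed KERNEL form, at regular U. -/
  kerG : ∀ i (α₀ : ℝ) (U : (bg i).Cfg), MInv ≤ (geo i).M → 0 < α₀ → (geo i).M * α₀ ≤ aInv → (bg i).Reg335 c35 α₀ U →
    HasKernelBound (g := toB6 (geo i) (Rr i) (Hp i)) (fun q : (κ × S i) × ι => blk i q.1.2) (vG i) cKvG (Gb i U)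
        (fun a a' => BKG * (geo i).len a ^ 2 * Real.exp (-(δKG * (geo i).dist a a'))) ∧
      (∀ k : κ ⊕ κ, HasKernelBound (g := toB6 (geo i) (Rr i) (Hp i)) (fun q : (κ × S i) × ι => blk i q.1.2) (vG i) cKvG
        (conj b (diffLetter (bT (T i)) (bU (coord i U)) ((((geo i).eta : ℂ))⁻¹) k) * Gb i U)
        (fun a a' => BKG * (geo i).len a * Real.exp (-(δKG * (geo i).dist a a')))) ∧
      (∀ l : κ ⊕ κ, HasKernelBound (g := toB6 (geo i) (Rr i) (Hp i)) (fun q : (κ × S i) × ι => blk i q.1.2) (vG i) cKvG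
        (Gb i U * conj b (diffLetter (bT (T i)) (bU (coord i U)) ((((geo i).eta : ℂ))⁻¹) l))
        (fun a a' => BKG * (geo i).len a * Real.exp (-(δKG * (geo i).dist a a')))) ∧
      (∀ k l : κ ⊕ κ, HasKernelBound (g := toB6 (geo i) (Rr i) (Hp i)) (fun q : (κ × S i) × ι => blk i q.1.2) (vG i) cKvG
        (conj b (diffLetter (bT (T i)) (bU (coord i U)) ((((geo i).eta : ℂ))⁻¹) k) * Gb i U *
          conj b (diffLetter (bT (T i)) (bU (coord i U)) ((((geo i).eta : ℂ))⁻¹) l))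
        (fun a a' => BKG * Real.exp (-(δKG * (geo i).dist a a'))))

variable (c35 geo bg Gp b κ S) in
/-- **THE LETTERS DICTIONARY FOR THE L² MEMBERS (3.46)₁,₂,₃,₅ OF G** — `KerGFrame` plus: the block-volume comparison `hvolG` of the
bond carrier in the kernel pairing (constant `cvG`, p. 393) and [4] Lemma 2.1 for `vG^{−1/2}` (`hSTvG`, `ΛvfG`) — the hypotheses of
`B9Ineq346L2Uniform.thm34_G_l2_uniform` verbatim — and the L² writing `writeL2G` (r06's conclusion (vii) for the family's own
G(U′U) at (B, δ/20) ⇒ the members n ∈ {0,1,2,4} of the (3.46) block of `GA` at U′U with (`wLG B δ`, `wLGδ δ`)).  A hypothesis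
structure; nothing asserted. [cite: Balaban1985BackgroundPropagators, (3.46) p.398 + Thm 3.3 p.399 + p.393 + p.398 remark + (3.84)–(3.86) p.407; Balaban1984PropagatorsII, (2.64)–(2.66) p.234 + Lemma 2.1 p.234] -/
structure L2GFrame (GA : ∀ i, B9.KernelFamily (geo i) (bg i)) (Cinv : ∀ i, B9.SiteKernel (geo i) (bg i))
    extends KerGFrame c35 geo bg Gp b κ S GA Cinv where
  cvG : ℝ
  ΛvfG : ℝ → ℝ → ℝ
  wLG : ℝ → ℝ → ℝ
  wLGδ : ℝ → ℝ
  cvG_nonneg : 0 ≤ cvG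
  ΛvfG_one_le : ∀ δ α : ℝ, 0 < δ → 0 < α → 1 ≤ ΛvfG δ α
  wLG_pos : ∀ B δ : ℝ, 0 ≤ B → 0 < δ → 0 < wLG B δ
  wLGδ_pos : ∀ δ : ℝ, 0 < δ → 0 < wLGδ δ
  hvolG : ∀ i (y : (geo i).Site),
    cKvG * ((Finset.univ.filter (fun q : (κ × S i) × ι => blk i q.1.2 = y)).card : ℝ) ≤ cvG * vG i y
  hSTvG : ∀ i (δ α : ℝ), 0 < δ → 0 < α → ScaleTransfer (geo i) δ α (ΛvfG δ α) (fun y => (Real.sqrt (vG i y))⁻¹)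
  /-- WRITING (3.46)₁,₂,₃,₅: r06's L² conclusion for the family's G(U′U) at (B, δ/20) ⇒ the members n = 0, 1, 2, 4 at U′U. -/
  writeL2G : ∀ i (U U' : (bg i).Cfg) (α₁ B δ : ℝ), 0 < α₁ → α₁ ≤ aW → (bg i).Cplx337 α₁ U U' → 0 ≤ B → 0 < δ →
    (∀ (y y' : (geo i).Site) (hf μ : (κ × S i) × ι → ℝ) (Hh : ℝ), 0 ≤ Hh → (∀ x, |hf x| ≤ Hh) →
      (∀ x, blk i x.1.2 ≠ y → hf x = 0) → (∀ x, blk i x.1.2 ≠ y' → μ x = 0) →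
      Real.sqrt (∑ x, (hf x * (Gb i ((bg i).mul U' U)) μ x) ^ 2) ≤
          B * Hh * (geo i).len y ^ 2 * Real.exp (-(1 / 20 * δ * (geo i).dist y y')) * Real.sqrt (∑ x, μ x ^ 2) ∧
        (∀ k : κ ⊕ κ, Real.sqrt (∑ x, (hf x * ((conj b (diffLetter (bT (T i)) (bU (coord i U)) ((((geo i).eta : ℂ))⁻¹) k)) *
            (Gb i ((bg i).mul U' U))) μ x) ^ 2) ≤
          B * Hh * (geo i).len y * Real.exp (-(1 / 20 * δ * (geo i).dist y y')) * Real.sqrt (∑ x, μ x ^ 2)) ∧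
        (∀ l : κ ⊕ κ, Real.sqrt (∑ x, (hf x * ((Gb i ((bg i).mul U' U)) *
            (conj b (diffLetter (bT (T i)) (bU (coord i U)) ((((geo i).eta : ℂ))⁻¹) l))) μ x) ^ 2) ≤
          B * Hh * (geo i).len y * Real.exp (-(1 / 20 * δ * (geo i).dist y y')) * Real.sqrt (∑ x, μ x ^ 2)) ∧
        (∀ k l : κ ⊕ κ, Real.sqrt (∑ x, (hf x * ((conj b (diffLetter (bT (T i)) (bU (coord i U)) ((((geo i).eta : ℂ))⁻¹) k)) *
            (Gb i ((bg i).mul U' U)) * (conj b (diffLetter (bT (T i)) (bU (coord i U)) ((((geo i).eta : ℂ))⁻¹) l))) μ x) ^ 2) ≤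
          B * Hh * Real.exp (-(1 / 20 * δ * (geo i).dist y y')) * Real.sqrt (∑ x, μ x ^ 2))) →
    ∀ n : Fin 6, n ≠ 3 → n ≠ 5 →
      ∀ (lam : (geo i).Loc) (h : (geo i).Cut) (y y' : (geo i).Site), (geo i).cutIn h y → (geo i).suppIn lam y' →
        (GA i).l2 n ((bg i).mul U' U) lam h ≤
          wLG B δ * B9.pref6 ((geo i).len y) n * (geo i).cutSup h * Real.exp (-(wLGδ δ * (geo i).dist y y')) * (geo i).l2Norm lam

/-- ★ **THE (3.46)₁,₂,₃,₅-STEPS OF SECT. B FOR G(U′U), INHABITED AT THE LETTERS GIVEN THE KERNEL-FORM LAW**: every `L2GFrame`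
inhabits `B9SectBStepWhole.StepL2nPos F.dB c35 geo bg Gp GA Cinv GA n` for the members n = 0, 1, 2, 4.  Proof: r06's
`thm34_G_l2_uniform` at the common pair `(max(cRG·B₀, B_KG), δr)`, `δr = min(min(δ₀, δ₁), min(δcap, δ_KG))`, of the read (3.42)
majorants and the law's kernel letters (both lowered to it), the three uniqueness identifications of `entries342_ext_of_gFrame`
(`gop_eq`, `cop_eq`, section identity + `coord_mul`, `gb_eq`), then `writeL2G`.  Honest scope: the kernel-form input is the
frame's law `kerG`, displayed — see the section note. [cite: Balaban1985BackgroundPropagators, Thm 3.4 p.400 + (3.46) p.398 + Thm 3.3 p.399 + p.398 remark + (3.84)–(3.86) p.407; Balaban1984PropagatorsII, (2.64)–(2.66) p.234 + Lemma 2.1 p.234] -/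
theorem stepL2nPos_of_l2GFrame {GA : ∀ i, B9.KernelFamily (geo i) (bg i)} {Cinv : ∀ i, B9.SiteKernel (geo i) (bg i)}
    (F : L2GFrame c35 geo bg Gp b κ S GA Cinv) (n : Fin 6) (hn3 : n ≠ 3) (hn5 : n ≠ 5) :
    B9SectBStepWhole.StepL2nPos F.dB c35 geo bg Gp GA Cinv GA n := by
  classical
  intro B₀ δ₀ Bβ Bε Bεβ B₁ δ₁ hB₀ hδ₀ hB₁ hδ₁
  -- the common rate and the common bond-sector constant of the call
  have hδr : 0 < min (min δ₀ δ₁) (min F.δcap F.δKG) := lt_min (lt_min hδ₀ hδ₁) (lt_min F.δcap_pos F.δKG_pos)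
  have hδr0 : min (min δ₀ δ₁) (min F.δcap F.δKG) ≤ δ₀ := le_trans (min_le_left _ _) (min_le_left _ _)
  have hδr1 : min (min δ₀ δ₁) (min F.δcap F.δKG) ≤ δ₁ := le_trans (min_le_left _ _) (min_le_right _ _)
  have hδrc : min (min δ₀ δ₁) (min F.δcap F.δKG) ≤ F.δcap := le_trans (min_le_right _ _) (min_le_left _ _)
  have hδrK : min (min δ₀ δ₁) (min F.δcap F.δKG) ≤ F.δKG := le_trans (min_le_right _ _) (min_le_right _ _)
  have hBG : 0 < F.cR * B₀ := mul_pos F.cR_pos hB₀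
  have hBb : 0 < F.cRG * B₀ := mul_pos F.cRG_pos hB₀
  have hBc : 0 < max (F.cRG * B₀) F.BKG := lt_max_of_lt_left hBb
  have hBK : 0 < F.cK * B₁ := mul_pos F.cK_pos hB₁
  have hcle : F.cRG * B₀ ≤ max (F.cRG * B₀) F.BKG := le_max_left _ _
  have hKle : F.BKG ≤ max (F.cRG * B₀) F.BKG := le_max_right _ _
  -- r06's uniform clauses: G′ (inverse identities of the extension) and the L² clause for G
  obtain ⟨a₁, ha₁, B', -, H'⟩ := thm34_Gp_uniform b κ F.dB (min (min δ₀ δ₁) (min F.δcap F.δKG)) (F.cR * B₀) F.Cq F.a₀ F.d₀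
    F.M₂ (F.Λf (min (min δ₀ δ₁) (min F.δcap F.δKG))) hBG F.Cq_nonneg F.a₀_nonneg F.M₂_nonneg hδr
    (fun α hα => F.Λf_one_le _ α hδr hα) F.hrepr
  obtain ⟨a₂, ha₂, B, hB, H⟩ := thm34_G_l2_uniform b κ F.dB (min (min δ₀ δ₁) (min F.δcap F.δKG)) (max (F.cRG * B₀) F.BKG)
    F.κQ (F.cR * B₀) (F.cK * B₁) F.cF F.Cq F.a₀ F.C₀ F.d₀ F.M₂ F.κQb F.cFb F.abar (F.Λf (min (min δ₀ δ₁) (min F.δcap F.δKG)))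
    (F.ΛvfG (min (min δ₀ δ₁) (min F.δcap F.δKG))) F.cvG hBc.le F.κQ_pos hBG hBK F.cF_pos F.Cq_nonneg F.a₀_nonneg F.C₀_nonneg
    F.M₂_nonneg hδr F.κQb_nonneg F.cFb_nonneg F.abar_nonneg (fun α hα => F.Λf_one_le _ α hδr hα)
    (fun α hα => F.ΛvfG_one_le _ α hδr hα) F.cvG_nonneg F.hrepr
  refine ⟨F.MInv, min (min a₁ a₂) F.aW, F.aInv, (F.wLG B (min (min δ₀ δ₁) (min F.δcap F.δKG)),
    F.wLGδ (min (min δ₀ δ₁) (min F.δcap F.δKG))), F.MInv_pos, lt_min (lt_min ha₁ ha₂) F.aW_pos, F.aInv_pos,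
    ⟨F.wLG_pos B _ hB hδr, F.wLGδ_pos _ hδr⟩, ?_⟩
  intro i hM α₀ hα₀ hMa U hU hT α₁ hα₁ ha U' hU' lam h y y' hcut hs
  have ha1 : α₁ ≤ a₁ := le_trans ha (le_trans (min_le_left _ _) (min_le_left _ _))
  have ha2 : α₁ ≤ a₂ := le_trans ha (le_trans (min_le_left _ _) (min_le_right _ _))
  have haW : α₁ ≤ F.aW := le_trans ha (min_le_right _ _)
  -- the site-sector letters at U
  obtain ⟨hΔG, hGΔ⟩ := F.reg_inv i α₀ U hM hα₀ hMa hU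
  obtain ⟨h1, h2, h3, -⟩ := F.read342 i α₀ U B₀ δ₀ hM hα₀ hMa hU hB₀ hδ₀ hT.1.1.1
  have hc2 : ∀ a : (geo i).Site, 0 ≤ F.cR * B₀ * (geo i).len a ^ 2 := fun a => mul_nonneg hBG.le (sq_nonneg _)
  have hc1 : ∀ a : (geo i).Site, 0 ≤ F.cR * B₀ * (geo i).len a := fun a => mul_nonneg hBG.le (F.len_pos i a).le
  have h1' := hasMajorant_rate_le (g := toB6 (geo i) (F.Rr i) (F.Hp i)) (fun p : S i × ι => F.blk i p.1)
    (fun a => (geo i).len a ^ 2) hc2 hδr0 (F.dist_nonneg i) h1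
  have h2' := fun k => hasMajorant_rate_le (g := toB6 (geo i) (F.Rr i) (F.Hp i)) (fun p : S i × ι => F.blk i p.1)
    (fun a => (geo i).len a) hc1 hδr0 (F.dist_nonneg i) (h2 k)
  have h3' := fun k => hasMajorant_rate_le (g := toB6 (geo i) (F.Rr i) (F.Hp i)) (fun p : S i × ι => F.blk i p.1)
    (fun a => (geo i).len a) hc1 hδr0 (F.dist_nonneg i) (h3 k)
  -- the (3.48) kernel of C⁻¹(U) at δ₁ lowered to δr
  have hK := F.readKer i α₀ U B₁ δ₁ hM hα₀ hMa hU hB₁ hδ₁ hT.2.1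
  have hK' : ∀ y y' : (geo i).Site, |B9Thm34Inv.ker (B9Thm34Inv.vol (geo i) F.dB) (F.Cop i U) y y'| ≤
      F.cK * B₁ * (geo i).len y ^ (-(4 : ℝ)) * (geo i).len y' ^ (-(F.dB : ℝ)) *
        Real.exp (-(min (min δ₀ δ₁) (min F.δcap F.δKG) * (geo i).dist y y')) := by
    intro y y'
    refine (hK y y').trans (mul_le_mul_of_nonneg_left (Real.exp_le_exp.2 ?_) ?_)
    · nlinarith [F.dist_nonneg i y y', hδr1]
    · exact mul_nonneg (mul_nonneg hBK.le (Real.rpow_nonneg (F.len_pos i y).le _))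
        (Real.rpow_nonneg (F.len_pos i y').le _)
  -- the bond-sector letters at U: inverse identities; (3.42) of G read at (cRG·B₀, δ₀) and the kernel law at (B_KG, δ_KG), both
  -- lowered to the common pair (max(cRG·B₀, B_KG), δr); (3.15) sizes at δr
  obtain ⟨hΔGb, hGbΔ⟩ := F.reg_ginv i α₀ U hM hα₀ hMa hU
  obtain ⟨g1, g2, g3, -⟩ := F.readG342 i α₀ U B₀ δ₀ hM hα₀ hMa hU hB₀ hδ₀ hT.2.2.1.1
  obtain ⟨k1, k2, k3, k4⟩ := F.kerG i α₀ U hM hα₀ hMa hU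
  have g1' := hasMajorant_mono (g := toB6 (geo i) (F.Rr i) (F.Hp i)) (fun q : (κ × S i) × ι => F.blk i q.1.2) g1
    (K' := fun a a' => max (F.cRG * B₀) F.BKG * (geo i).len a ^ 2 *
      Real.exp (-(min (min δ₀ δ₁) (min F.δcap F.δKG) * (geo i).dist a a')))
    fun (a a' : (geo i).Site) => prof_le (sq_nonneg ((geo i).len a)) hcle hBc.le hδr0 (F.dist_nonneg i a a')
  have g2' := fun k => hasMajorant_mono (g := toB6 (geo i) (F.Rr i) (F.Hp i)) (fun q : (κ × S i) × ι => F.blk i q.1.2) (g2 k)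
    (K' := fun a a' => max (F.cRG * B₀) F.BKG * (geo i).len a *
      Real.exp (-(min (min δ₀ δ₁) (min F.δcap F.δKG) * (geo i).dist a a')))
    fun (a a' : (geo i).Site) => prof_le (F.len_pos i a).le hcle hBc.le hδr0 (F.dist_nonneg i a a')
  have g3' := fun k => hasMajorant_mono (g := toB6 (geo i) (F.Rr i) (F.Hp i)) (fun q : (κ × S i) × ι => F.blk i q.1.2) (g3 k)
    (K' := fun a a' => max (F.cRG * B₀) F.BKG * (geo i).len a *
      Real.exp (-(min (min δ₀ δ₁) (min F.δcap F.δKG) * (geo i).dist a a')))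
    fun (a a' : (geo i).Site) => prof_le (F.len_pos i a).le hcle hBc.le hδr0 (F.dist_nonneg i a a')
  have k1' := hasKernelBound_mono (g := toB6 (geo i) (F.Rr i) (F.Hp i)) (fun q : (κ × S i) × ι => F.blk i q.1.2) (F.vG_pos i) k1
    (K' := fun a a' => max (F.cRG * B₀) F.BKG * (geo i).len a ^ 2 *
      Real.exp (-(min (min δ₀ δ₁) (min F.δcap F.δKG) * (geo i).dist a a')))
    fun (a a' : (geo i).Site) => prof_le (sq_nonneg ((geo i).len a)) hKle hBc.le hδrK (F.dist_nonneg i a a')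
  have k2' := fun k => hasKernelBound_mono (g := toB6 (geo i) (F.Rr i) (F.Hp i)) (fun q : (κ × S i) × ι => F.blk i q.1.2)
    (F.vG_pos i) (k2 k)
    (K' := fun a a' => max (F.cRG * B₀) F.BKG * (geo i).len a *
      Real.exp (-(min (min δ₀ δ₁) (min F.δcap F.δKG) * (geo i).dist a a')))
    fun (a a' : (geo i).Site) => prof_le (F.len_pos i a).le hKle hBc.le hδrK (F.dist_nonneg i a a')
  have k3' := fun l => hasKernelBound_mono (g := toB6 (geo i) (F.Rr i) (F.Hp i)) (fun q : (κ × S i) × ι => F.blk i q.1.2)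
    (F.vG_pos i) (k3 l)
    (K' := fun a a' => max (F.cRG * B₀) F.BKG * (geo i).len a *
      Real.exp (-(min (min δ₀ δ₁) (min F.δcap F.δKG) * (geo i).dist a a')))
    fun (a a' : (geo i).Site) => prof_le (F.len_pos i a).le hKle hBc.le hδrK (F.dist_nonneg i a a')
  have k4' := fun k l => hasKernelBound_mono (g := toB6 (geo i) (F.Rr i) (F.Hp i)) (fun q : (κ × S i) × ι => F.blk i q.1.2)
    (F.vG_pos i) (k4 k l)
    (K' := fun a a' => max (F.cRG * B₀) F.BKG * Real.exp (-(min (min δ₀ δ₁) (min F.δcap F.δKG) * (geo i).dist a a')))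
    fun (a a' : (geo i).Site) => by
      have h := prof_le (p := 1) zero_le_one hKle hBc.le hδrK (F.dist_nonneg i a a')
      simpa only [mul_one] using h
  have hQb := F.hQb i U _ hδr hδrc
  have hQsb := F.hQsb i U _ hδr hδrc
  -- the class (3.37) read blockwise; the (3.57), (3.80)–(3.81) letters; (3.35) on plaquettes
  obtain ⟨hkF, hsF, h337B, h337F, h337Bτ, hA, hAτB⟩ := F.cplx i α₁ U U' hα₁ hU'
  obtain ⟨h337B', h337FB, hAτF, hAFB, hAst, hAloc, hdAst⟩ := F.cplxG i α₁ U U' hα₁ hU'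
  obtain ⟨hQm, hQsm⟩ := F.q_mul i α₁ U U' hα₁ hU'
  obtain ⟨hFc, hFcs⟩ := F.hF i α₁ U U' hα₁ hU'
  obtain ⟨hQbm, hQsbm⟩ := F.qb_mul i α₁ U U' hα₁ hU'
  obtain ⟨hF₂, hF₂s⟩ := F.hF₂ i α₁ U U' hα₁ hU' _ hδr hδrc
  have h35 := F.reg335 i α₀ U hM hα₀ hMa hU
  -- the G′ clause: the family's G′(U′U) is r06's extension
  obtain ⟨hinv1, hinv2, -, -⟩ := H' (F.T i) (F.coord i U) (F.blk i) (F.kQ i U) (F.sQ i U) (F.cfun i) (F.w i U)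
    (F.dist_nonneg i) (F.triangle i) (F.dist_self i) (F.dist_comm i) (F.len_pos i) (F.eta_le_len i) (F.eta_pos i)
    (fun α hα hα1 => F.h261 i _ α hδr hα hα1) (fun α hα => F.hST i _ α hδr hα) (F.unitary i U)
    (F.stencilB i) (F.stencilF i) (F.stencil0 i) (F.w_nonneg i U) (F.card_w i U) (F.hkQ i U) (F.hsQ i U) (F.hcfun i)
    hΔG hGΔ h1' h2' h3' α₁ hα₁.le ha1 (F.expA i U U') (F.kF i U U') (F.sF i U U')
    hkF hsF h337B h337F h337Bτ hA hAτB
  have hGp := F.gop_eq i ((bg i).mul U' U) _ _ (F.mul_law i α₁ U U' hα₁ hU') hinv1 hinv2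
  -- the L² clause for G
  obtain ⟨Tinv, GExt, hT1, hT2, hG1, hG2, hL2⟩ := H (F.T i) (F.coord i U) (F.blk i) (F.kQ i U) (F.sQ i U)
    (F.cfun i) (F.w i U)
    (F.dist_nonneg i) (F.triangle i) (F.dist_self i) (F.dist_comm i) (F.len_pos i) (F.eta_le_len i) (F.eta_pos i)
    (F.L_one_le i) (fun α hα hα1 => F.h261 i _ α hδr hα hα1) (fun α hα => F.hST i _ α hδr hα) (F.T_comm i)
    (F.unitary i U) h35 (F.stencilB i) (F.stencilF i) (F.stencilFB i) (F.stencilSt i) (F.stencilLoc i) (F.stencil0 i)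
    (F.w_nonneg i U) (F.card_w i U) (F.hkQ i U) (F.hsQ i U) (F.hcfun i)
    h1' h2' h3' hΔG hGΔ (F.rep i) (F.hrep i) (F.hQc i U) (F.hQcs i U) (F.reg_cinv i α₀ U hM hα₀ hMa hU) hK'
    hQb hQsb (F.ha324 i) hΔGb hGbΔ g1' g2' g3' (F.vG_pos i) F.cKvG_pos k1' k2' k3' k4' (F.hvolG i)
    (fun α hα => F.hSTvG i _ α hδr hα) α₁ hα₁.le ha2 (F.expA i U U') (F.kF i U U') (F.sF i U U')
    hkF hsF h337B h337F h337B' h337Bτ h337FB hA hAτB hAτF hAFB hAst hAloc hdAst hQm hQsm hFc hFcs hQbm hQsbm rfl hF₂ hF₂s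
  -- the three identifications
  rw [← hGp] at hT1 hT2 hG1 hG2
  have hC := F.cop_eq i ((bg i).mul U' U) _ Tinv rfl hT1 hT2
  rw [← hC] at hG1 hG2
  have hinj : Function.Injective (F.rep i) := fun y₁ y₂ h => by
    have e := congrArg (fun p : S i × ι => F.blk i p.1) h
    simpa only [F.hrep] using e
  rw [rZero_add_pPrime_sections hinj, ← F.coord_mul i α₁ U U' hα₁ hU'] at hG1 hG2
  have hGb := F.gb_eq i ((bg i).mul U' U) _ GExt rfl hG1 hG2
  rw [← hGb] at hL2
  exact F.writeL2G i U U' α₁ B (min (min δ₀ δ₁) (min F.δcap F.δKG)) hα₁ haW hU' hB hδr hL2 n hn3 hn5 lam h y y' hcut hs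


/-! ## (v1.1) The Hölder block (3.43) of G(U′U) at the letters — from r06's per-probe transfers, kernel-form input displayed

r06's `B9Thm34HolderAllUniform.thm34_all_holder_uniform` transfers, PER PROBE (a left letter `D` or a right letter `D_s` with a
(3.42)₃-type entry, a real-linear functional `Φ` of the 𝔸-valued output, an anchor block `y ∋ p₀`, an exponent and sizes
`B_h, c_ζ ≧ 0`), the (3.43)-type members from G(U) to G(U′U) (clauses (iii), (iv)); its inputs are those of the G-clause PLUS
Theorem 3.3 for G(U) in the printed kernel form — so the frame below extends `KerGFrame` (the law `kerG`) by the single transfer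
field `h1G_transfer`, exactly as `B9SectBGpStepAtLetters.H1Frame` does for G′. -/

variable (c35 geo bg Gp b κ S) in
/-- **THE LETTERS DICTIONARY FOR THE HÖLDER BLOCK (3.43) OF G** — `KerGFrame` plus ONE transfer field: given the (3.42) and (3.43)
blocks of `GA` at U (rate δ₀), a call rate `0 < δ ≦ δ₀` and call constant `Bc ≧ cRG·B₀`, and r06's two PER-PROBE Hölder transfers
(iii) (derivative on the left) and (iv) (derivative on the right, inputs (a) (b) (c) per right letter `D_s` with a (3.42)₃-type
entry at (Bc, δ)) for the family's own `G(U′U)` with constant `B` at rate δ/6, the (3.43) block of `GA` holds at U′U with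
(`wHG B δ Bβ`, `wHGδ δ`).  The probes are the instance's Hölder difference quotients (3.40) on the bond carrier; nothing asserted.
[cite: Balaban1985BackgroundPropagators, (3.43) p.398 + (3.40) p.397 + Thm 3.3 p.399 + p.407; Balaban1984PropagatorsII, (2.51) p.232] -/
structure H1GFrame (GA : ∀ i, B9.KernelFamily (geo i) (bg i)) (Cinv : ∀ i, B9.SiteKernel (geo i) (bg i))
    extends KerGFrame c35 geo bg Gp b κ S GA Cinv where
  wHG : ℝ → ℝ → (ℝ → ℝ) → (ℝ → ℝ)
  wHGδ : ℝ → ℝ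
  wHGδ_pos : ∀ δ : ℝ, 0 < δ → 0 < wHGδ δ
  /-- THE TRANSFER: r06's per-probe (3.43) transfers (iii) (left) and (iv) (right) for `G(U′U)` ⇒ the (3.43) block of `GA` at U′U. -/
  h1G_transfer : ∀ i (α₀ : ℝ) (U U' : (bg i).Cfg) (α₁ B₀ Bc B δ₀ δ : ℝ) (Bβ : ℝ → ℝ),
    MInv ≤ (geo i).M → 0 < α₀ → (geo i).M * α₀ ≤ aInv → (bg i).Reg335 c35 α₀ U →
    0 < α₁ → α₁ ≤ aW → (bg i).Cplx337 α₁ U U' → 0 < B₀ → cRG * B₀ ≤ Bc → 0 ≤ B → 0 < δ → δ ≤ δ₀ →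
    EBlock (GA i) B₀ δ₀ U → B9FromB6.H1Block (GA i) Bβ δ₀ U →
    -- (iii) r06's left transfer, for every probe
    (∀ (D : Module.End ℝ ((κ × S i) × ι → ℝ)) (Φ : (κ × S i → 𝔸) →ₗ[ℝ] 𝔸) (y : (geo i).Site) (p₀ : (κ × S i) × ι),
      blk i p₀.1.2 = y → ∀ (β Bh cζ : ℝ), 0 ≤ Bh → 0 ≤ cζ →
        (∀ (y' : (geo i).Site) (μ : (κ × S i) × ι → ℝ) (M : ℝ),
          B6RandomWalk.BlockSupp (g := toB6 (geo i) (Rr i) (Hp i)) (fun q : (κ × S i) × ι => blk i q.1.2) μ y' M →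
          ‖Φ ((B9Eq352DivFormLetters.coordEquiv b).symm (D (Gb i U μ)))‖ ≤
            Bh * (geo i).len y ^ (1 - β) * cζ * Real.exp (-(δ * (geo i).dist y y')) * M) →
        ∀ (y' : (geo i).Site) (μ : (κ × S i) × ι → ℝ) (M : ℝ),
          B6RandomWalk.BlockSupp (g := toB6 (geo i) (Rr i) (Hp i)) (fun q : (κ × S i) × ι => blk i q.1.2) μ y' M →
          ‖Φ ((B9Eq352DivFormLetters.coordEquiv b).symm (D (Gb i ((bg i).mul U' U) μ)))‖ ≤
            B * Bh * (geo i).len y ^ (1 - β) * cζ * Real.exp (-(δ / 6 * (geo i).dist y y')) * M) →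
    -- (iv) r06's right transfer, for every right letter with a (3.42)₃-type entry at (Bc, δ) and every probe
    (∀ (Ds : Module.End ℝ ((κ × S i) × ι → ℝ)),
      HasMajorant (g := toB6 (geo i) (Rr i) (Hp i)) (fun q : (κ × S i) × ι => blk i q.1.2) (Gb i U * Ds)
        (fun a a' => Bc * (geo i).len a * Real.exp (-(δ * (geo i).dist a a'))) →
      ∀ (Φ : (κ × S i → 𝔸) →ₗ[ℝ] 𝔸) (y : (geo i).Site) (p₀ : (κ × S i) × ι), blk i p₀.1.2 = y →
      ∀ (γ Bh cζ : ℝ), 0 ≤ Bh → 0 ≤ cζ →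
        (∀ (y' : (geo i).Site) (μ : (κ × S i) × ι → ℝ) (M : ℝ),
          B6RandomWalk.BlockSupp (g := toB6 (geo i) (Rr i) (Hp i)) (fun q : (κ × S i) × ι => blk i q.1.2) μ y' M →
          ‖Φ ((B9Eq352DivFormLetters.coordEquiv b).symm (Gb i U μ))‖ ≤
            Bh * (geo i).len y ^ (2 - γ) * cζ * Real.exp (-(δ * (geo i).dist y y')) * M) →
        (∀ (k : κ ⊕ κ) (y' : (geo i).Site) (μ : (κ × S i) × ι → ℝ) (M : ℝ),
          B6RandomWalk.BlockSupp (g := toB6 (geo i) (Rr i) (Hp i)) (fun q : (κ × S i) × ι => blk i q.1.2) μ y' M →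
          ‖Φ ((B9Eq352DivFormLetters.coordEquiv b).symm
              ((Gb i U * conj b (diffLetter (bT (T i)) (bU (coord i U)) ((((geo i).eta : ℂ))⁻¹) k)) μ))‖ ≤
            Bh * (geo i).len y ^ (1 - γ) * cζ * Real.exp (-(δ * (geo i).dist y y')) * M) →
        (∀ (y' : (geo i).Site) (μ : (κ × S i) × ι → ℝ) (M : ℝ),
          B6RandomWalk.BlockSupp (g := toB6 (geo i) (Rr i) (Hp i)) (fun q : (κ × S i) × ι => blk i q.1.2) μ y' M →
          ‖Φ ((B9Eq352DivFormLetters.coordEquiv b).symm ((Gb i U * Ds) μ))‖ ≤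
            Bh * (geo i).len y ^ (1 - γ) * cζ * Real.exp (-(δ * (geo i).dist y y')) * M) →
        ∀ (y' : (geo i).Site) (μ : (κ × S i) × ι → ℝ) (M : ℝ),
          B6RandomWalk.BlockSupp (g := toB6 (geo i) (Rr i) (Hp i)) (fun q : (κ × S i) × ι => blk i q.1.2) μ y' M →
          ‖Φ ((B9Eq352DivFormLetters.coordEquiv b).symm ((Gb i ((bg i).mul U' U) * Ds) μ))‖ ≤
            B * Bh * (geo i).len y ^ (1 - γ) * cζ * Real.exp (-(δ / 6 * (geo i).dist y y')) * M) →
    B9FromB6.H1Block (GA i) (wHG B δ Bβ) (wHGδ δ) ((bg i).mul U' U)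

/-- ★ **THE (3.43)-STEP OF SECT. B FOR G(U′U), INHABITED AT THE LETTERS GIVEN THE KERNEL-FORM LAW**: every `H1GFrame` inhabits
`B9SectBStepWhole.StepH1Pos F.dB c35 geo bg Gp GA Cinv GA` (outputs `wHG B δr Bβ`, `wHGδ δr`, `δr = min(min(δ₀, δ₁), min(δcap, δKG))`).
Proof: r06's `B9Thm34HolderAllUniform.thm34_all_holder_uniform` at the common pair `(max(cRG·B₀, B_KG), δr)` (constants `a₁, B`
before the member; its clause (i) gives the inverse identities identifying the family's G′(U′U) with r06's extension), the
three uniqueness identifications of `entries342_ext_of_gFrame`, then the frame's transfer field on clauses (iii), (iv).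
Honest scope: the kernel-form input is the law `kerG`, displayed. [cite: Balaban1985BackgroundPropagators, Thm 3.4 p.400 + Thm 3.3 (3.43) pp.398–399 + p.407 + (3.68) p.403; Balaban1984PropagatorsII, Lemma 2.1 p.234] -/
theorem stepH1Pos_of_h1GFrame {GA : ∀ i, B9.KernelFamily (geo i) (bg i)} {Cinv : ∀ i, B9.SiteKernel (geo i) (bg i)}
    (F : H1GFrame c35 geo bg Gp b κ S GA Cinv) :
    B9SectBStepWhole.StepH1Pos F.dB c35 geo bg Gp GA Cinv GA := by
  classical
  intro B₀ δ₀ Bβ Bε Bεβ B₁ δ₁ hB₀ hδ₀ hB₁ hδ₁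
  have hδr : 0 < min (min δ₀ δ₁) (min F.δcap F.δKG) := lt_min (lt_min hδ₀ hδ₁) (lt_min F.δcap_pos F.δKG_pos)
  have hδr0 : min (min δ₀ δ₁) (min F.δcap F.δKG) ≤ δ₀ := le_trans (min_le_left _ _) (min_le_left _ _)
  have hδr1 : min (min δ₀ δ₁) (min F.δcap F.δKG) ≤ δ₁ := le_trans (min_le_left _ _) (min_le_right _ _)
  have hδrc : min (min δ₀ δ₁) (min F.δcap F.δKG) ≤ F.δcap := le_trans (min_le_right _ _) (min_le_left _ _)
  have hδrK : min (min δ₀ δ₁) (min F.δcap F.δKG) ≤ F.δKG := le_trans (min_le_right _ _) (min_le_right _ _)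
  have hBG : 0 < F.cR * B₀ := mul_pos F.cR_pos hB₀
  have hBb : 0 < F.cRG * B₀ := mul_pos F.cRG_pos hB₀
  have hBc : 0 < max (F.cRG * B₀) F.BKG := lt_max_of_lt_left hBb
  have hBK : 0 < F.cK * B₁ := mul_pos F.cK_pos hB₁
  have hcle : F.cRG * B₀ ≤ max (F.cRG * B₀) F.BKG := le_max_left _ _
  have hKle : F.BKG ≤ max (F.cRG * B₀) F.BKG := le_max_right _ _
  obtain ⟨a₂, ha₂, B, hB, H⟩ := B9Thm34HolderAllUniform.thm34_all_holder_uniform b κ F.dB (min (min δ₀ δ₁) (min F.δcap F.δKG))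
    (max (F.cRG * B₀) F.BKG) F.κQ (F.cR * B₀) (F.cK * B₁) F.cF F.Cq F.a₀ F.C₀ F.d₀ F.M₂ F.κQb F.cFb F.abar
    (F.Λf (min (min δ₀ δ₁) (min F.δcap F.δKG))) hBc.le F.κQ_pos hBG hBK F.cF_pos F.Cq_nonneg F.a₀_nonneg F.C₀_nonneg
    F.M₂_nonneg hδr F.κQb_nonneg F.cFb_nonneg F.abar_nonneg (fun α hα => F.Λf_one_le _ α hδr hα) hBc F.hrepr
  refine ⟨F.MInv, min a₂ F.aW, F.aInv,
    (F.wHG B (min (min δ₀ δ₁) (min F.δcap F.δKG)) Bβ, F.wHGδ (min (min δ₀ δ₁) (min F.δcap F.δKG))),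
    F.MInv_pos, lt_min ha₂ F.aW_pos, F.aInv_pos, F.wHGδ_pos _ hδr, ?_⟩
  intro i hM α₀ hα₀ hMa U hU hT α₁ hα₁ ha U' hU'
  have ha2 : α₁ ≤ a₂ := le_trans ha (min_le_left _ _)
  have haW : α₁ ≤ F.aW := le_trans ha (min_le_right _ _)
  -- the site-sector letters at U
  obtain ⟨hΔG, hGΔ⟩ := F.reg_inv i α₀ U hM hα₀ hMa hU
  obtain ⟨h1, h2, h3, -⟩ := F.read342 i α₀ U B₀ δ₀ hM hα₀ hMa hU hB₀ hδ₀ hT.1.1.1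
  have hc2 : ∀ a : (geo i).Site, 0 ≤ F.cR * B₀ * (geo i).len a ^ 2 := fun a => mul_nonneg hBG.le (sq_nonneg _)
  have hc1 : ∀ a : (geo i).Site, 0 ≤ F.cR * B₀ * (geo i).len a := fun a => mul_nonneg hBG.le (F.len_pos i a).le
  have h1' := hasMajorant_rate_le (g := toB6 (geo i) (F.Rr i) (F.Hp i)) (fun p : S i × ι => F.blk i p.1)
    (fun a => (geo i).len a ^ 2) hc2 hδr0 (F.dist_nonneg i) h1
  have h2' := fun k => hasMajorant_rate_le (g := toB6 (geo i) (F.Rr i) (F.Hp i)) (fun p : S i × ι => F.blk i p.1)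
    (fun a => (geo i).len a) hc1 hδr0 (F.dist_nonneg i) (h2 k)
  have h3' := fun k => hasMajorant_rate_le (g := toB6 (geo i) (F.Rr i) (F.Hp i)) (fun p : S i × ι => F.blk i p.1)
    (fun a => (geo i).len a) hc1 hδr0 (F.dist_nonneg i) (h3 k)
  -- the (3.48) kernel of C⁻¹(U) at δ₁ lowered to δr
  have hK := F.readKer i α₀ U B₁ δ₁ hM hα₀ hMa hU hB₁ hδ₁ hT.2.1
  have hK' : ∀ y y' : (geo i).Site, |B9Thm34Inv.ker (B9Thm34Inv.vol (geo i) F.dB) (F.Cop i U) y y'| ≤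
      F.cK * B₁ * (geo i).len y ^ (-(4 : ℝ)) * (geo i).len y' ^ (-(F.dB : ℝ)) *
        Real.exp (-(min (min δ₀ δ₁) (min F.δcap F.δKG) * (geo i).dist y y')) := by
    intro y y'
    refine (hK y y').trans (mul_le_mul_of_nonneg_left (Real.exp_le_exp.2 ?_) ?_)
    · nlinarith [F.dist_nonneg i y y', hδr1]
    · exact mul_nonneg (mul_nonneg hBK.le (Real.rpow_nonneg (F.len_pos i y).le _))
        (Real.rpow_nonneg (F.len_pos i y').le _)
  -- the bond-sector letters at U: (3.42) of G read at (cRG·B₀, δ₀) and the kernel law at (B_KG, δ_KG), both lowered to the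
  -- common pair; (3.15) sizes at δr
  obtain ⟨hΔGb, hGbΔ⟩ := F.reg_ginv i α₀ U hM hα₀ hMa hU
  obtain ⟨g1, g2, g3, -⟩ := F.readG342 i α₀ U B₀ δ₀ hM hα₀ hMa hU hB₀ hδ₀ hT.2.2.1.1
  obtain ⟨k1, k2, k3, k4⟩ := F.kerG i α₀ U hM hα₀ hMa hU
  have g1' := hasMajorant_mono (g := toB6 (geo i) (F.Rr i) (F.Hp i)) (fun q : (κ × S i) × ι => F.blk i q.1.2) g1
    (K' := fun a a' => max (F.cRG * B₀) F.BKG * (geo i).len a ^ 2 *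
      Real.exp (-(min (min δ₀ δ₁) (min F.δcap F.δKG) * (geo i).dist a a')))
    fun (a a' : (geo i).Site) => prof_le (sq_nonneg ((geo i).len a)) hcle hBc.le hδr0 (F.dist_nonneg i a a')
  have g2' := fun k => hasMajorant_mono (g := toB6 (geo i) (F.Rr i) (F.Hp i)) (fun q : (κ × S i) × ι => F.blk i q.1.2) (g2 k)
    (K' := fun a a' => max (F.cRG * B₀) F.BKG * (geo i).len a *
      Real.exp (-(min (min δ₀ δ₁) (min F.δcap F.δKG) * (geo i).dist a a')))
    fun (a a' : (geo i).Site) => prof_le (F.len_pos i a).le hcle hBc.le hδr0 (F.dist_nonneg i a a')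
  have g3' := fun k => hasMajorant_mono (g := toB6 (geo i) (F.Rr i) (F.Hp i)) (fun q : (κ × S i) × ι => F.blk i q.1.2) (g3 k)
    (K' := fun a a' => max (F.cRG * B₀) F.BKG * (geo i).len a *
      Real.exp (-(min (min δ₀ δ₁) (min F.δcap F.δKG) * (geo i).dist a a')))
    fun (a a' : (geo i).Site) => prof_le (F.len_pos i a).le hcle hBc.le hδr0 (F.dist_nonneg i a a')
  have k1' := hasKernelBound_mono (g := toB6 (geo i) (F.Rr i) (F.Hp i)) (fun q : (κ × S i) × ι => F.blk i q.1.2) (F.vG_pos i) k1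
    (K' := fun a a' => max (F.cRG * B₀) F.BKG * (geo i).len a ^ 2 *
      Real.exp (-(min (min δ₀ δ₁) (min F.δcap F.δKG) * (geo i).dist a a')))
    fun (a a' : (geo i).Site) => prof_le (sq_nonneg ((geo i).len a)) hKle hBc.le hδrK (F.dist_nonneg i a a')
  have k2' := fun k => hasKernelBound_mono (g := toB6 (geo i) (F.Rr i) (F.Hp i)) (fun q : (κ × S i) × ι => F.blk i q.1.2)
    (F.vG_pos i) (k2 k)
    (K' := fun a a' => max (F.cRG * B₀) F.BKG * (geo i).len a *
      Real.exp (-(min (min δ₀ δ₁) (min F.δcap F.δKG) * (geo i).dist a a')))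
    fun (a a' : (geo i).Site) => prof_le (F.len_pos i a).le hKle hBc.le hδrK (F.dist_nonneg i a a')
  have k3' := fun l => hasKernelBound_mono (g := toB6 (geo i) (F.Rr i) (F.Hp i)) (fun q : (κ × S i) × ι => F.blk i q.1.2)
    (F.vG_pos i) (k3 l)
    (K' := fun a a' => max (F.cRG * B₀) F.BKG * (geo i).len a *
      Real.exp (-(min (min δ₀ δ₁) (min F.δcap F.δKG) * (geo i).dist a a')))
    fun (a a' : (geo i).Site) => prof_le (F.len_pos i a).le hKle hBc.le hδrK (F.dist_nonneg i a a')
  have k4' := fun k l => hasKernelBound_mono (g := toB6 (geo i) (F.Rr i) (F.Hp i)) (fun q : (κ × S i) × ι => F.blk i q.1.2)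
    (F.vG_pos i) (k4 k l)
    (K' := fun a a' => max (F.cRG * B₀) F.BKG * Real.exp (-(min (min δ₀ δ₁) (min F.δcap F.δKG) * (geo i).dist a a')))
    fun (a a' : (geo i).Site) => by
      have h := prof_le (p := 1) zero_le_one hKle hBc.le hδrK (F.dist_nonneg i a a')
      simpa only [mul_one] using h
  have hQb := F.hQb i U _ hδr hδrc
  have hQsb := F.hQsb i U _ hδr hδrc
  -- the class (3.37) read blockwise; the (3.57), (3.80)–(3.81) letters; (3.35) on plaquettes
  obtain ⟨hkF, hsF, h337B, h337F, h337Bτ, hA, hAτB⟩ := F.cplx i α₁ U U' hα₁ hU'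
  obtain ⟨h337B', h337FB, hAτF, hAFB, hAst, hAloc, hdAst⟩ := F.cplxG i α₁ U U' hα₁ hU'
  obtain ⟨hQm, hQsm⟩ := F.q_mul i α₁ U U' hα₁ hU'
  obtain ⟨hFc, hFcs⟩ := F.hF i α₁ U U' hα₁ hU'
  obtain ⟨hQbm, hQsbm⟩ := F.qb_mul i α₁ U U' hα₁ hU'
  obtain ⟨hF₂, hF₂s⟩ := F.hF₂ i α₁ U U' hα₁ hU' _ hδr hδrc
  have h35 := F.reg335 i α₀ U hM hα₀ hMa hU
  -- r06's Hölder clauses: (i) identifies G′(U′U), (iii)/(iv) transfer per probe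
  obtain ⟨hinv1, hinv2, -, -, Tinv, GExt, hT1, hT2, hG1, hG2, hHL, hHR⟩ := H (F.T i) (F.coord i U) (F.blk i) (F.kQ i U)
    (F.sQ i U) (F.cfun i) (F.w i U)
    (F.dist_nonneg i) (F.triangle i) (F.dist_self i) (F.dist_comm i) (F.len_pos i) (F.eta_le_len i) (F.eta_pos i)
    (F.L_one_le i) (fun α hα hα1 => F.h261 i _ α hδr hα hα1) (fun α hα => F.hST i _ α hδr hα) (F.T_comm i)
    (F.unitary i U) h35 (F.stencilB i) (F.stencilF i) (F.stencilFB i) (F.stencilSt i) (F.stencilLoc i) (F.stencil0 i)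
    (F.w_nonneg i U) (F.card_w i U) (F.hkQ i U) (F.hsQ i U) (F.hcfun i)
    h1' h2' h3' hΔG hGΔ (F.rep i) (F.hrep i) (F.hQc i U) (F.hQcs i U) (F.reg_cinv i α₀ U hM hα₀ hMa hU) hK'
    hQb hQsb (F.ha324 i) hΔGb hGbΔ g1' g2' g3' (F.vG_pos i) F.cKvG_pos k1' k2' k3' k4'
    α₁ hα₁.le ha2 (F.expA i U U') (F.kF i U U') (F.sF i U U')
    hkF hsF h337B h337F h337B' h337Bτ h337FB hA hAτB hAτF hAFB hAst hAloc hdAst hQm hQsm hFc hFcs hQbm hQsbm rfl hF₂ hF₂s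
  have hGp := F.gop_eq i ((bg i).mul U' U) _ _ (F.mul_law i α₁ U U' hα₁ hU') hinv1 hinv2
  rw [← hGp] at hT1 hT2 hG1 hG2
  have hC := F.cop_eq i ((bg i).mul U' U) _ Tinv rfl hT1 hT2
  rw [← hC] at hG1 hG2
  have hinj : Function.Injective (F.rep i) := fun y₁ y₂ h => by
    have e := congrArg (fun p : S i × ι => F.blk i p.1) h
    simpa only [F.hrep] using e
  rw [rZero_add_pPrime_sections hinj, ← F.coord_mul i α₁ U U' hα₁ hU'] at hG1 hG2
  have hGb := F.gb_eq i ((bg i).mul U' U) _ GExt rfl hG1 hG2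
  rw [← hGb] at hHL hHR
  exact F.h1G_transfer i α₀ U U' α₁ B₀ (max (F.cRG * B₀) F.BKG) B δ₀ (min (min δ₀ δ₁) (min F.δcap F.δKG)) Bβ hM hα₀ hMa hU
    hα₁ haW hU' hB₀ hcle hB hδr hδr0 hT.2.2.1.1 hT.2.2.2.1 hHL hHR

end Literature.MathematicalPhysics.QuantumFieldTheory.Balaban1983to89.B9SectBGStepAtLetters
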